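import Mathlib
import HarnessLib
import HarnessLib.Audit
import Summits.HodgeConjecture.Statement
import Literature.AlgebraicGeometry.Motives.Differentials
import Literature.AlgebraicGeometry.HodgeTheory.ComplexGysin
import Literature.AlgebraicGeometry.HodgeTheory.HodgeFiltration
import Literature.AlgebraicGeometry.HodgeTheory.HodgeConjecture
import Literature.Geometry.Kaehler.HolomorphicChartForms
import Summits.HodgeConjecture.HodgeConjecture.Theorems.NikulinTwinTransportEEightTwoSimilitudeStandalone
import Literature.AlgebraicGeometry.Surfaces.K3PeriodSurjectivity
-- import Summits.HodgeConjecture.HodgeConjecture.Theorems.NikulinTwinTransportTwinAnchorGlueHolds dropped: it (transitively) imports this route file — proofs used by `closes`/`_holds` must live in a module that does not import the Theses file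

/-!
Route: NikulinTwinTransport

DORMANT since 2026-09-04T23:38:31Z (reconciler: no traction for 5 d (last activity item-evidence-added at 2026-08-30T23:01:50Z); parked, not closed — `ledger route dormant route-HodgeConjecture-NikulinTwinTransport --off` to reactivate) — unstaffed, not closed; items shared with open routes are served there. `ledger route dormant <id> --off` reactivates.

# Route NikulinTwinTransport — Real multiplication by √2 on K3 surfaces from one Nikulin quotient —
rational Hodge 2-similitudes of K3s are algebraic, carried off the Nikulin locus as c₂ of a
hyperholomorphic Serre sheaf

X = Sim₂(K3) (card nikulin-serre-bundle-k3-similitudes; D-0027 §2.1-conforming re-open of the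
retired route
NikulinTwinSimilitude, now over the landed `IsK3Surface`): for every pair of projective K3 surfaces
S, S′ over ℂ, every
rational Hodge similitude of multiplier 2, ψ : H²(S′,ℚ) → H²(S,ℚ) with (ψx.ψy) = 2(x.y), is
algebraic — ψ = [γ]_* =
fst_*(snd^*(–) ∪ γ) for an algebraic class γ of codimension 2 on S × S′ (item
TwinSimilitudeAlgebraic, rank 0, crux). By Buskin's
theorem (support HodgeIsometryAlgebraic = the tree's named fact verbatim) X is equivalent to:
graph(Ψ) is algebraic on S × S′
for every twin pair (S,S′) of ONE completed Nikulin 2-similitude Ψ = g^* ⊕ (N_j ↦ r_j) (eight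
pairwise orthogonal roots r_j
of E₈(−2)); it is algebraic at the Nikulin anchor (X, Y′) and the route carries m·graph(Ψ) along the
twin locus as c₂ of a
polystable hyperholomorphic Serre-type sheaf on X × Y′ (the carrier K1, NikulinSerreCarrier —
line-level content of the transport
crux since rev 9; crux TwinTwistorTransport r4, typed at OUTPUT level — every projective K3 surface
S has a projective K3 partner S″
and an ALGEBRAIC ℂ-linear equivalence Ψ : H²(S″) ≃ H²(S) whose inverse is a rational,
type-preserving ½-similitude — glued to X by
the support TwinAnchorGlue : HodgeIsometryAlgebraic → TwinTwistorTransport →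
TwinSimilitudeAlgebraic, i.e. Ψ⁻¹∘ψ is a rational Hodge
isometry, Buskin, composition of correspondences: the landed
Theorems.twinSimilitudeAlgebraic_of_anchor / twinAnchorGlue_of_corrComp).
SECTOR AND FRAME (revs 11–12, crux-only repair of the deciding theorem): X and Lefschetz (1,1) give
— by the self-similitude
factorisation of real multiplication (RealMultiplicationGlue, landed modulo the two named K3 facts
as
Theorems…realMultiplicationGlue_of_marking_of_hodgeTypes) and Künneth bookkeeping on S ⊗ S
(SquareGlue, landed modulo the Künneth
criterion as Theorems…squareGlue_of_kunnethCriterion) — HodgeConjectureFor 4 (S ⊗ S) for every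
projective K3 surface S with
End_Hdg(T(S)_ℚ) = ℚ(√2): the SECTOR, crux SquareHodgeOfSqrtTwo (rank 6; the first totally-real case,
CM squares being the tree fact
Buskin2019_hodgeConjectureFor_square_of_CM). The summit is partitioned into that sector and its
declared COMPLEMENT, crux
SectorComplement : SquareHodgeOfSqrtTwo → HodgeConjecture (rank 7, summit-grade, listed as a crux
per D-0027 §2.2 'bridges are
components: the sector and the complementary sector are both cruxes'); `closes` is that partition
and assumes the two cruxes only.
Lean: `∀ (μ : Literature.AlgebraicGeometry.HodgeTheory.OrientationFamily), μ.HasPoincareDuality → ∀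
(S S' : Literature.AlgebraicGeometry.Motives.SchemeOver ℂ) (hS :
Literature.AlgebraicGeometry.Surfaces.IsK3Surface S) (hS' :
Literature.AlgebraicGeometry.Surfaces.IsK3Surface S') (p :
Literature.AlgebraicGeometry.HodgeTheory.complexBetti S (2 * 2)) (p' :
Literature.AlgebraicGeometry.HodgeTheory.complexBetti S' (2 * 2)),
(Literature.AlgebraicGeometry.HodgeTheory.IsIntegralClass p ∧ ∀ q :
Literature.AlgebraicGeometry.HodgeTheory.complexBetti S (2 * 2),
Literature.AlgebraicGeometry.HodgeTheory.IsIntegralClass q → ∃ n : ℤ, q = n • p) →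
(Literature.AlgebraicGeometry.HodgeTheory.IsIntegralClass p' ∧ ∀ q :
Literature.AlgebraicGeometry.HodgeTheory.complexBetti S' (2 * 2),
Literature.AlgebraicGeometry.HodgeTheory.IsIntegralClass q → ∃ n : ℤ, q = n • p') → ∀ (ψ :
Literature.AlgebraicGeometry.HodgeTheory.complexBetti S' (2 * 1) →ₗ[ℂ]
Literature.AlgebraicGeometry.HodgeTheory.complexBetti S (2 * 1)), (∀ x,
Literature.AlgebraicGeometry.HodgeTheory.IsRationalClass x →
Literature.AlgebraicGeometry.HodgeTheory.IsRationalClass (ψ x)) → (∀ (i j : ℕ) x,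
Literature.AlgebraicGeometry.HodgeTheory.IsOfHodgeType 2 S' (2 * 1) i j x →
Literature.AlgebraicGeometry.HodgeTheory.IsOfHodgeType 2 S (2 * 1) i j (ψ x)) → (∀ (x y :
Literature.AlgebraicGeometry.HodgeTheory.complexBetti S' (2 * 1)) (a : ℂ),
Literature.AlgebraicTopology.SingularHomology.cupProduct (rfl : 2 * 1 + 2 * 1 = 2 * 2) x y = a • p'
→ Literature.AlgebraicTopology.SingularHomology.cupProduct (rfl : 2 * 1 + 2 * 1 = 2 * 2) (ψ x) (ψ y)
= ((2 : ℂ) * a) • p) → ∃ γ ∈ Literature.AlgebraicGeometry.HodgeTheory.algebraicClasses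
(CategoryTheory.MonoidalCategoryStruct.tensorObj S S') 2, ∀ x :
Literature.AlgebraicGeometry.HodgeTheory.complexBetti S' (2 * 1), ψ x =
Literature.AlgebraicGeometry.HodgeTheory.complexGysin μ
(Literature.AlgebraicGeometry.Motives.IsSmoothProjective.tensor_holds hS.1 hS'.1) hS.1
(CategoryTheory.SemiCartesianMonoidalCategory.fst S S') (rfl : 2 * 1 + 2 * 2 + 2 * 2 = 2 * 1 + 2 *
(2 + 2)) (Literature.AlgebraicTopology.SingularHomology.cupProduct (rfl : 2 * 1 + 2 * 2 = 2 * 1 + 2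
* 2) (Literature.AlgebraicGeometry.HodgeTheory.complexBetti.map
(CategoryTheory.SemiCartesianMonoidalCategory.snd S S') (2 * 1) x) γ)`

## Assembly
The DECIDING THEOREM (D-0027 §2.1, rev 12; kinds re-triaged at rev 11) is `closes (h₁ :
SquareHodgeOfSqrtTwo) (h₂ : SectorComplement) : _root_.HodgeConjecture
:= h₂ h₁` — both binders are CRUX items (crux-only rule, human ruling 2026-08-16: the deciding
theorem assumes cruxes and nothing
else); every other item enters through DERIVATIONS that are implication items of this route:
SquareHodgeOfSqrtTwo ⇐ SquareGlue
(RealMultiplicationSqrtTwoAlgebraic → LefschetzOneOneK3 → SquareHodgeOfSqrtTwo) ⇐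
RealMultiplicationGlue (TwinSimilitudeAlgebraic →
HodgeIsometryAlgebraic → TwinExists → LefschetzOneOneK3 → RealMultiplicationSqrtTwoAlgebraic) ⇐ X; X
⇐ TwinAnchorGlue
(HodgeIsometryAlgebraic → TwinTwistorTransport → TwinSimilitudeAlgebraic) ⇐ the transport crux; X ⇐
AllMultipliersGlue ⇐
HodgeSimilitudeAlgebraic. Since rev 13 (route-repair judge-repair) the transport crux has ONE ranked
special case, crux TwinTransportRMPicardTwo
(rank 3, stmt-HodgeConjecture-15067): its conclusion for projective K3 surfaces of Picard rank 2
carrying a rational Hodge endomorphism e of H²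
killing NS with e² = 2 on NS^⊥ — i.e. the Picard-rank-2 members of the maximal 8-dimensional RM-√2
families of van Geemen–Schütt
(arXiv:2310.05196 Thm 3.10), all OFF the Nikulin locus (rank T = 20 > 12, Varesco2023 §2) — the
judge's 'what would move it' (2026-08-16:
TwinTwistorTransport proved for one RM-by-√2 family off the Nikulin locus) made a staffable,
HC-implied item strictly weaker than the transport
crux (TwinTwistorTransport → TwinTransportRMPicardTwo, planner Sketch2.lean rc 0). State of the
derivation lemmas (kernel-checked, Theorems/NikulinTwinTransport*.lean): RealMultiplicationGlue
holds given Huybrechts_K3_marking_exists + Huybrechts_K3_hodgeTypes_H2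
(realMultiplicationGlue_of_marking_of_hodgeTypes — Buskin and the
universal twin are not even needed: e + a divisor correction is itself a rational Hodge 2-similitude
of H²(S), algebraic by X with
S′ = S); SquareGlue holds given the Künneth criterion for End_Hdg(H²(S)) on S ⊗ S, Künneth spanning
and three named facts
(squareGlue_of_kunnethCriterion); TwinExists given markings + period surjectivity + Hodge types
(twinExists_of_marking_periodSurjective_hodgeTypes); LefschetzOneOneK3 given
lefschetzOneOne_rational
(lefschetzOneOneK3_of_lefschetzOneOne_rational); TwinAnchorGlue given composition of degree-2
correspondences between surfaces
(twinAnchorGlue_of_corrComp); the rev-4 frame item Assembly (X → Buskin → TwinExists → L(1,1) →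
SectorComplement → HodgeConjecture,
kept because six Theorems files conclude it by name) given SquareGlue + the two K3 facts
(assembly_of_squareGlue_of_marking_of_hodgeTypes).
So the day X (or the transport crux + Buskin, or the all-multipliers crux) is proved, the sector
closes modulo named Literature
facts and Künneth formal debt, and `closes` fires modulo the complement crux. WHY THE BINDERS ARE
THE SECTOR AND ITS COMPLEMENT
rather than X + six supports (the rev 3–10 shape `closes (h₁ : LefschetzOneOneK3) … (h₇ :
SectorComplement) := h₇ (h₆ (h₅ h₂ h₃ h₄
h₁) h₁)`, stamped glue.non-crux-hypothesis): the three staffed cruxes TwinSimilitudeAlgebraic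
(13674), TwinTwistorTransport (14393),
HodgeSimilitudeAlgebraic (13676) plus four routine inputs as cruxes would exceed the cap of seven;
every finer decl of the route is
concluded or assumed BY NAME in landed Theorems files (no restating or dropping without breaking
kernel-checked files); and the
sector is the WEAKEST statement through which this line reaches the summit — any proof of it (via X,
via all multipliers, or
directly on the 8-dimensional van Geemen–Schütt RM families) fires `closes`. Native cone note:
`#h21_check_closes` expands items only
through their definiens, so TwinSimilitudeAlgebraic, TwinTwistorTransport, TwinTransportRMPicardTwo
and HodgeSimilitudeAlgebraic are listed
under the ADVISORY glue.unused-crux although the implication items above derive the binder h₁ from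
them (the views/priority cone follows
implication items; TwinTwistorTransport and HodgeSimilitudeAlgebraic were already so listed at rev
10). CONE NOTE (rev 7,
unchanged): the route file imports no module carrying an unproved named fact — K3Surface /
K3PeriodSurjectivity / K3Marking are
deliberately not imported (Buskin is the inline item HodgeIsometryAlgebraic; markings, period
surjectivity and Hodge types of H²(K3)
enter only the proofs of TwinExists / TwinTwistorTransport / the glue lemmas, as hypotheses there).
Ground note (rev 4):
TwinTwistorTransport, RealMultiplicationSqrtTwoAlgebraic and SquareHodgeOfSqrtTwo are
`ground.skipped` (elaborated size over the
battery cap, from the verbatim-unfolded IsK3Surface body) — informational, statements unchanged.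

Rationale: WHY THIS LINE. Buskin2019 (reproof Huybrechts2019) makes every rational Hodge ISOMETRY between
projective K3 surfaces algebraic by carrying a
stable sheaf on S × M along twistor lines as a hyperholomorphic bundle
(Verbitsky1996Hyperholomorphic); Markman2024 does the same for K3^[n] type
with twisted sheaves; the totally-real part of End_Hdg(T) — real multiplication — is untouched, and
Varesco2023 Thm 2.1 / Prop 2.5 gets √p
algebraic only ON the Nikulin / σ_p locus (T ⊂ U³_ℚ ⊕ E₈(−2)_ℚ, dim T ≤ 13), while real
multiplication lives on 8-dimensional families where
no cycle is known (VanGeemenSchuett2023, VanGeemen2008RM). The card's move: leave the Nikulin locus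
by completing g^* to a RATIONAL 2-similitude
Ψ (2Ψ integral, Disproof §A) of the whole K3 lattice with eight orthogonal roots of E₈(−2) — so
every K3 has a twin with Ψ Hodge, and
2·graph(Ψ), unlike the naive graph, is SU(2)-invariant for Ψ-matched product hyperkähler structures
— and transport it as c₂ of a polystable
Serre-type sheaf whose obstruction group vanishes on the nose because the even eight is 2-divisible.
Imported: hyperkähler/twistor geometry + Yang–Mills
(hyperholomorphic = polystable with invariant c₁, c₂), lattice theory of Nikulin involutions
(VanGeemenSarti2007, Morrison1984), Hodge theory
of K3 (Zarhin1983); no spectral/probabilistic/model-theoretic import; certified computation only for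
the lattice item. Versus
the negatives index (2 entries, unrelated) and prior routes: NikulinTwinSimilitude (same card) was
retired only for its frame; KugaSatakeSaturation
reaches the same classes CONDITIONALLY on KS-HC; the retired EvenB2Twistor keeps S × S and E-stable
lines, no anchor for similitudes — here
the anchor is a 2:1 map between two OTHER K3s.

RANKED CRUXES. Six cruxes since rev 13: the thesis X, the transport mechanism and (rank 3, rev 13)
its maximal-RM-family special case — the
judge's milestone —, the all-multipliers strengthening, and the two binders of `closes` — the sector
and its complement.
#0 TwinSimilitudeAlgebraic (crux, rank 0; the thesis X, auto-crux since rev 8) — X = Sim₂(K3): for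
projective K3 surfaces S, S′ (IsK3Surface
unfolded), integral generators p, p′ of H⁴, and every ℂ-linear ψ : H²(S′(ℂ);ℂ) → H²(S(ℂ);ℂ) that is
rational, type-preserving and a 2-similitude
((x.y) = a·p′ ⟹ (ψx.ψy) = 2a·p), there is γ ∈ algebraicClasses (S ⊗ S′) 2 with ψ = fst_*(snd^*(–) ∪
γ). Feeds the binder h₁ through
RealMultiplicationGlue + SquareGlue. (why it might fail: open sub-case of HC — known only on the
Nikulin locus (Varesco2023 Thm 2.1, Prop 2.5)
and for CM pairs; on the maximal RM-√2 families no inducing cycle is known (arXiv:2310.05196 Rem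
4.9); one non-algebraic ψ refutes HC.) [Varesco2023, arXiv:2304.02519, VanGeemenSchuett2023,
Buskin2019, Huybrechts2019]
#3 TwinTransportRMPicardTwo (crux, rank 3; stmt-HodgeConjecture-15067, added rev 13 by route-repair
judge-repair with `workitem add` — the
judge's 'what would move it': TwinTwistorTransport proved for one RM-by-√2 family off the Nikulin
locus) — THE TRANSPORT CRUX ON THE MAXIMAL RM-√2
FAMILIES: the conclusion of #4 verbatim (K3 partner S″, generator p″, ALGEBRAIC Ψ : H²(S″) ≃ H²(S)
with rational, type-preserving, form-halving
inverse) for every projective K3 surface S of Picard rank 2 (finrank_ℂ algebraicClasses S 1 = 2)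
carrying an endomorphism e of H²(S(ℂ);ℂ) that is
rational, type-preserving, kills NS and has e(e x) = 2x on NS^⊥ (so √2 ∈ End_Hdg(T(S)_ℚ): a Hodge
morphism T → NS vanishes, T being irreducible;
self-adjointness (automatic, Zarhin) and End-exactness are not assumed — the 4000-char signature
path — so the class is ALL Picard-rank-2 members
of the maximal 8-dim RM-√2 families, special members included). Such S have rank T = 20
(arXiv:2310.05196 Thm 3.10: Pic = U(r), T = U ⊕ U(r) ⊕
E₈², √2 = the explicit integral M; §3.9: no other maximal family known) and lie OFF the Nikulin
locus (Varesco2023 Prop 2.5, §2: on-locus RM-√2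
families have dim ≤ 4, rank T ≤ 12), where no instance of the transport conclusion is known
(Disproof.lean of 14393: known cases need ρ ≥ 9);
also #4 ⟹ #3 (planner Sketch2.lean rc 0). At End-generic S, given Buskin + L(1,1), #3 ⟺ √2 algebraic
on T(S) (⇒ pointwise twin trick of
RealMultiplicationGlue; ⇐ for Pic ≅ U(r): S″ = S, Ψ = e ⊕ ν, ν(u,v) = (2u,v) the divisor-induced
2-similitude of U(r)_ℚ) ⟺ HC for S × S there
(ibid. Rem 4.9). MILESTONE RULE: a proof for ONE maximal family (e.g. r = 1: elliptic K3 with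
section, T = U² ⊕ E₈²) lands under --supports and is
the judge's evidence (spreading out + specialisation of cycles over the base covers every member of
that family); the item closes when all
ρ = 2 RM-√2 surfaces are covered. CONSISTENCY (paper): at the CM members with CM field ∋ ζ₈
(arXiv:1507.08547 Thm 3) the anchor already follows
from TwinExists + Buskin + CM-square HC (2 = (1+i)(1−i) a relative norm). [deps:
TwinTwistorTransport] [difficulty: open-problem] (why it might
fail: open HC sub-case, no known instance — no cycle inducing √2 known on the maximal families
(arXiv:2310.05196 Rem 4.9), Varesco2023 Thm 2.1
stops at rank T ≤ 12; the carrier must cross MT-generic twins; a non-algebraic anchor refutes HC.)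
[VanGeemenSchuett2023, arXiv:2310.05196,
Varesco2023, arXiv:2304.02519, VanGeemen2008RM, Buskin2019, arXiv:1507.08547]
#4 TwinTwistorTransport (crux) — K2 TRANSPORT ALONG THE TWIN LOCUS, typed at OUTPUT level (rev 7):
every projective K3 surface S (integral
generator p of H⁴) has a projective K3 partner S″ (generator p″) and an ALGEBRAIC ℂ-linear
equivalence Ψ : H²(S″(ℂ);ℂ) ≃ H²(S(ℂ);ℂ) (Ψ = [γ]_*,
γ ∈ algebraicClasses (S ⊗ S″) 2) whose inverse is rational, type-preserving and halves the cup form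
— verbatim hypothesis (A) of the landed
Theorems.twinSimilitudeAlgebraic_of_anchor; feeds X through the support TwinAnchorGlue (+ Buskin);
its maximal-RM-family case is #3. The lattice-level form (ONE rational 2-similitude M of Λ_K3,
twin similitude algebraic on every M-twin pair of marked K3s) implies it via markings + period
surjectivity + Hodge types (landed Theorems
anchorAt_of_twinTransport, c = 2); mechanism: (a) product Verbitsky/Kaledin–Verbitsky with Ψ-matched
structures, (b) generic diagonal twistor
chains (Markman2024 §5), (c) GAGA/κ₂ endpoint, from the carrier K1 at the Nikulin anchor
(NikulinSerreCarrier, line-level,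
Cruxes/NikulinSerreCarrier/). [deps: HodgeIsometryAlgebraic] [difficulty: XL] (why it might fail:
open HC sub-case — an algebraic multiplier-2
similitude into every projective K3 is known only on the Nikulin locus, Varesco2023 Thm 2.1; the
anchor carrier may not exist and Ψ-matched
transport through MT-generic twins is unproved.) [Varesco2023, arXiv:2304.02519, Buskin2019,
Markman2024,
arXiv:2204.00516, Verbitsky1996Hyperholomorphic, Huybrechts2016K3]
#5 HodgeSimilitudeAlgebraic (crux) — ALL MULTIPLIERS: for every rational r > 0, every rational Hodge
similitude of multiplier r between H² of
projective K3 surfaces is algebraic. Plan: one anchor per prime — symplectic automorphisms of order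
3, 5, 7 (X ⇢ X/σ_p resolved,
anti-invariant lattices K_p completed by roots; Varesco2023 §2) and Kummer anchors Km(A) ⇢ Km(A′)
for l-isogenies — each transported as in #4;
multipliers multiply, squares are isometries, so primes suffice. r = 2 is X: feeds X through the
support
AllMultipliersGlue (provable now). Output: HC(S × S) for every K3 whose End_Hdg(T) is spanned by
square roots of rationals. [deps:
TwinSimilitudeAlgebraic] [difficulty: open-problem] (why it might fail: no symplectic automorphism
of prime order p > 7 exists (Nikulin), so
large-p anchors must be Kummer/isogeny quotients whose completed similitude may admit no
SU(2)-invariant integral completion; known only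
conditionally on Kuga–Satake HC (Varesco2023 Thm 0.3).) [Varesco2023, Huybrechts2016K3, Buskin2019,
Morrison1984, VanGeemen2008RM]
#6 SquareHodgeOfSqrtTwo (crux since rev 11, ledger rank 9; binder h₁ of `closes`) — THE SECTOR, in
the summit's own predicate: HodgeConjectureFor 4 (S ⊗ S)
for every projective K3 S with End_Hdg(T(S)_ℚ) = ℚ + ℚ·e, e² = 2 — hypotheses spelled on the real
carriers (e rational, type-preserving,
cup-self-adjoint, kills NS := algebraicClasses S 1, e² = 2 on NS^⊥, and every rational
type-preserving f killing NS with image ⊥ NS is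
a + b·e there). First totally-real case of HC for K3 squares beyond CM (tree fact
Buskin2019_hodgeConjectureFor_square_of_CM); it contains the
maximal 8-dim RM families of VanGeemenSchuett2023. Derived in-route from X: X → L(1,1) →
RealMultiplicationSqrtTwoAlgebraic (landed modulo the
two K3 facts) → SquareHodgeOfSqrtTwo (SquareGlue, landed modulo the Künneth criterion); the WEAKEST
statement through which the line
reaches the summit, hence the binder; a direct attack (explicit cycles on the van Geemen–Schütt RM
families; Kuga–Satake with definite
quaternion multiplication, VanGeemen2008RM) closes the route as well. [difficulty: open-problem]
(why it might fail: open sub-case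
of HC — on the maximal 8-dim families of K3s with RM by ℚ(√2) no inducing cycle for e is known
(arXiv:2310.05196 §4.9); proved only for CM
squares (Buskin2019) and on the Nikulin locus (Varesco2023 Thm 2.1); a non-algebraic e refutes HC.)
[VanGeemenSchuett2023, arXiv:2310.05196,
Varesco2023, VanGeemen2008RM, Buskin2019, Zarhin1983]
#7 SectorComplement (crux since rev 11, ledger rank 9; binder h₂ of `closes`) — THE COMPLEMENT of
the sector: SquareHodgeOfSqrtTwo → HodgeConjecture, i.e. the
Hodge conjecture for every smooth projective variety granted its K3-square-with-RM-√2 case.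
Summit-grade by construction (implied by HC;
¬SectorComplement ⟹ ¬HC); a CRUX so that the deciding theorem assumes cruxes only and the route
audits `full`, not bridge-only (D-0027
§2.2). This line's mechanism does not bear on it; its content is what the summit's other open routes
attack (LinearSystemTorelli,
EndoscopicMiddleDegree, CurveNetMordellWeil, PadicSemiregularLift, …); lowest rank. Kernel-checked
bookkeeping
(Theorems…SectorComplement.lean): HodgeConjecture ↔ SquareHodgeOfSqrtTwo ∧ SectorComplement.
[difficulty: open-problem] (why it might fail:
HC off one thin sector is the whole summit — false iff HC fails elsewhere while holding on K3
squares with RM √2, e.g. a non-algebraic Weil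
class on an abelian fourfold (MoonenZarhin1999) or on a very general hypersurface; irrefutable short
of ¬HC, unprovable short of HC there.)
[Deligne2000, MoonenZarhin1999, VoisinHodgeI2002, Andre1996]
SUPPORTS (rank 9 unless stated; not binders, so they close as lemmas): #2 HodgeIsometryAlgebraic
(rank 2) — Buskin's theorem, H²-version,
VERBATIM the body of the tree's named fact Buskin2019_hodgeIsometry_algebraic (restated, not named:
the used-constants cone stays free of
undischarged facts); used by TwinAnchorGlue and as an antecedent of RealMultiplicationGlue; fails
only AS RENDERED (sign/normalisation of
complexGysin or of p, p′ — then restate); formalising Buskin is XL. [Buskin2019, Huybrechts2019,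
arXiv:1705.04063] · TwinExists — the universal twin (markings + EEightTwoSimilitude + period
surjectivity; landed
modulo the three Huybrechts_K3_* facts as twinExists_of_marking_periodSurjective_hodgeTypes).
[Huybrechts2016K3] · LefschetzOneOneK3 — Lefschetz (1,1) for projective K3 (n = 2 slice of
lefschetzOneOne_rational:
lefschetzOneOneK3_of_lefschetzOneOne_rational; Chern–Weil / rigidity reductions in
Theorems…LefschetzOneOneK3*.lean). [VoisinHodgeI2002] ·
RealMultiplicationSqrtTwoAlgebraic — THE DELIVERABLE (√2 on T(S) is algebraic); standalone open
(VanGeemenSchuett2023), in-route derived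
from X + L(1,1) (realMultiplicationSqrtTwoAlgebraic_of_marking_of_hodgeTypes, modulo the two K3
facts). [Varesco2023, Zarhin1983] · RealMultiplicationGlue — X → Buskin → TwinExists → L(1,1) →
RealMultiplicationSqrtTwoAlgebraic; LANDED modulo
Huybrechts_K3_marking_exists + _hodgeTypes_H2 (realMultiplicationGlue_of_marking_of_hodgeTypes: ψ :=
e + divisor correction is a rational Hodge
self-2-similitude of H²(S), algebraic by X; Buskin, twin, Witt unused). [Varesco2023,
Huybrechts2019] · SquareGlue
— RealMultiplicationSqrtTwoAlgebraic → L(1,1) → SquareHodgeOfSqrtTwo, Künneth bookkeeping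
(Varesco2023 p. 8); LANDED modulo the Künneth criterion for
End_Hdg(H²(S)) on S ⊗ S, Künneth spanning and three named facts (squareGlue_of_kunnethCriterion).
[Varesco2023, Fulton1998] · EEightTwoSimilitude — PROVED (eEightTwoSimilitude_standalone). ·
TwinAnchorGlue — Buskin → TwinTwistorTransport → X; landed modulo composition of degree-2
correspondences between surfaces
(twinAnchorGlue_of_corrComp; Buskin2019 Lemma 6.3, Fulton1998 Prop 16.1.1). · AllMultipliersGlue —
HodgeSimilitudeAlgebraic → X (r = 2;
= the landed theorem twinSimilitudeAlgebraic_of_hodgeSimilitudeAlgebraic; refuter-certified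
trivial). · Assembly (rank 1) — the rev-4 frame X → Buskin → TwinExists → L(1,1) → SectorComplement
→
HodgeConjecture; follows from SquareGlue + the two K3 facts
(assembly_of_squareGlue_of_marking_of_hodgeTypes); kept because six Theorems
files conclude it by name.

TWO-LAYER PLAN. Landed layer-1 glue: TwinAnchorGlue (Buskin → #4 → X), AllMultipliersGlue (#5 → X;
also the landed theorem
twinSimilitudeAlgebraic_of_hodgeSimilitudeAlgebraic), RealMultiplicationGlue + SquareGlue (X →
sector); to land by any prover:
twinTransportRMPicardTwo_of_twinTwistorTransport (#4 → #3, two lines, planner Sketch2.lean).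
Foreseen glued splits (none filed now): TwinTwistorTransport ⇐ NikulinSerreCarrier (re-added
TYPED, same decl name, as NikulinSerreCarrierAlg of Cruxes/NikulinSerreCarrier/TypedCruxAlg.lean
with the disprovers' two repairs — m : ℂ,
`IsRationalClass Ω →` in SignNormalised — once defn-IsKaehlerClass / defn-IsMuStableBetti land) →
CarrierTransport
(Ψ-matched product Verbitsky + generic twin chains + GAGA ⇒ TwinTransportFor[M], then
anchorAt_of_twinTransport); or ⇐ LatticeTwinTransport →
K3PeriodFacts; HodgeSimilitudeAlgebraic ⇐ OrderThreeFiveSevenAnchors → KummerIsogenyAnchors →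
(composition with Buskin); SquareHodgeOfSqrtTwo ⇐ (X-free alternative) ExplicitRMCycles on the van
Geemen–Schütt families → KunnethCriterion;
TwinTransportRMPicardTwo ⇐ OneMaximalFamily (U(r)-polarised, vGS's M: explicit correspondence or
Kuga–Satake quaternion cycle, spread over
the base) → LatticeTypeExhaustion (every rank-20 (T, e) of signature (2,18) with hyperbolic
complement is a treated type). k ≤ 3 each, depth 1.

KILL CRITERIA. (i) Carrier dies: the Serre bundle F and every elementary modification with the
required Chern classes is ω⊞ω′-unstable (destabilising
subsheaf of non-invariant c₁) for all Ψ-matched Kähler pairs near the anchor, AND the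
twisted/derived-McKay fallbacks fail ⇒ the carrier is dead (evidence:
Cruxes/NikulinSerreCarrier/Disproof.lean) and, unless a carrier-free line on #4
(ordinary-prime-anchors, …) or a direct line on #6 / #3 survives, the route closes `exhausted`,
handing the similitude bookkeeping to
KugaSatakeSaturation. (ii) A Voisin-type theorem 'on a very general twin pair every (twisted)
coherent sheaf on S × S′ has c₂ with zero graph(Ψ)-component'
kills the transport line (#3, #4) outright. (iii) ¬TwinSimilitudeAlgebraic,
¬TwinTransportRMPicardTwo, ¬SquareHodgeOfSqrtTwo or ¬SectorComplement each refute HC itself: close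
`refuted:<Decl>`, file the witness on the summit's negative side. (iv) HodgeIsometryAlgebraic found
mis-rendered
(sign/normalisation of complexGysin) ⇒ restate, never close. (v) Mooted if HC for products of K3s
lands otherwise (KugaSatakeSaturation +
KS-HC).

NOT DECOMPOSED YET. Below X the transport crux and (rev 13) its maximal-RM-family special case are
items, typed at OUTPUT level (the
lattice-level form and the three K3 facts live crux-side: their modules would carry unproved named
facts into the import cone). The other
off-locus Picard ranks (4, 6, 8; equally open) and single-family statements (fixed (Pic, T, M)
lattice data) are NOT items: single-family
theorems land under --supports of TwinTransportRMPicardTwo. The CARRIER K1 (NikulinSerreCarrier,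
14464) was dropped as an
item at rev 9 (informal ⇒ no decl); its mathematics (lines, TypedCrux(Alg).lean, Disproof §A–§O,
landed Theorems …NikulinSerreCarrier*) stays in
Cruxes/NikulinSerreCarrier/ as material for lines on #4 / #3 until the typed item returns (TWO-LAYER
PLAN). The
complement crux is not decomposed here (its sectors belong to other routes); Nikulin family, carrier
rank, twisted vs untwisted transport, m
and the other primes are below crux level. Formal debts named, not itemised: Künneth with
Hodge types, product Hodge models, the Künneth criterion (SquareGlue); composition/transpose of
algebraic correspondences (TwinAnchorGlue);
markings / period surjectivity / Hodge types of H²(K3), lefschetzOneOne_rational (named facts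
entering the landed glue lemmas as hypotheses) —
prover lemmas under --supports or Literature facts; needs-fact: Huybrechts_K3_marking_exists,
Huybrechts_K3_hodgeTypes_H2,
Huybrechts_K3_periodSurjective_projective, lefschetzOneOne_rational,
Buskin2019_hodgeIsometry_algebraic.

CHEAPEST FALSIFIER. Run the transport argument with ι = id (Ψ = id, graph = diagonal, carrier an
I_Δ-type sheaf on S × S) and with a
Mukai/Fourier–Mukai partner: it must reproduce Buskin2019 verbatim — if the Ψ-matched
SU(2)-invariance or the product-Verbitsky step already
fails there, the line is dead. Next cheapest: slope-(semi)stability of the rank-2 Serre bundle F on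
X × Y′ for ω ⊞ ω′, ω = Ψ(ω′), as N_j.ω′ → 0,
against pr₂^*O(aδ + Σ b_jN_j) and I_Γ ⊗ pr₂^*O(δ) via the Koszul sequence (pen and paper); `decide`
on EEightTwoSimilitude (done). For #6 directly: the ρ = 16 members of the van Geemen–Schütt families
(arXiv:2310.05196 §4) — is e induced by an explicit
isogeny/Shioda–Inose-type correspondence there? For #3 (HC-implied: no kill cheaper than (ii)/(iii))
the cheapest PROGRESS test is the r = 1
family: does vGS's M ⊕ ν lift to a correspondence on the Weierstrass model built from a degree-2
base change and a fibrewise 2-isogeny of a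
pulled-back fibration (ibid. §6 needs a 2-torsion section, forcing ρ ≥ 10 — does a multisection
version survive at ρ = 2)?

NUMBERS. Multiplier 2; expected m = 2 (c₂^{mixed} = 2·graph Ψ); E₈(2) ⊂ E₈ of index 16 (A₁⁸ frame);
T-rank ≤ 13 on the Nikulin locus
(Varesco2023 Prop 2.5) against 21 in general; the twin correspondence is
19-dimensional, dominant on both factors; no symplectic automorphism of prime order > 7. Items: revs
11–12: 15 = 5 cruxes (X r0, TwinTwistorTransport r4,
HodgeSimilitudeAlgebraic r5, SquareHodgeOfSqrtTwo / SectorComplement at ledger rank 9, here #6/#7) +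
9 support (1 proved) + 1 assembly, `closes`
with 2 crux hypotheses; rev 13 (judge-repair): + crux TwinTransportRMPicardTwo r3 (15067, via
`workitem add`; route-edit add/restate/split all bounced —
the cap validator counts 16 top-level rows incl. the superseded proved Assembly 13683 — and
`workitem add` was the open path), `closes`
unchanged. RM-√2 families: dim = rank T/2 − 2, so ρ = 2, 4, 6, 8 give dim 8, 7, 6, 5, all off the
Nikulin locus (on-locus: dim ≤ 4, Varesco2023
§2); the one known algebraic RM-√2 family (arXiv:2310.05196 Prop 6.2) has ρ = 10, dim 4, RM induced
by a degree-2 self-map.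

DEFINITION REQUESTS. Still wanted: hyperkähler metric / twistor family of (products of) K3s
(Literature/AlgebraicGeometry/Hyperkaehler),
slope-(poly)stability of coherent analytic sheaves w.r.t. a Kähler class, their Chern classes in
complexBetti; defn-IsKaehlerClass and
defn-IsMuStableBetti (filed 2026-08-16, crux-plan of 14464) — when they land, re-add
NikulinSerreCarrier typed. Cite facts wanted: Verbitsky's
theorem (Verbitsky1996Hyperholomorphic Thm 2.5); twistor-path connectivity (Huybrechts2016K3 Ch.7
Prop.3.7). Landed, used only as hypotheses of
glue lemmas (never imported by the route file): IsK3Surface,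
Buskin2019_hodgeConjectureFor_square_of_CM,
Grothendieck1969_supportedClasses_le_hodgeConiveau and the needs-fact list above.

Novelty: Searches (2026-08-15): this seat — `lit search "Hodge similarity K3 surfaces algebraic
transcendental lattice" --year-from 2019`
(rc 75, searchd unavailable at 18:55 and 19:05, retried before open), `lean search` over the tree
(new since gen-0: K3Surface.lean,
K3ComplexMultiplication.lean, K3PeriodSurjectivity.lean — the CM square is now a tree fact, the RM
square is not), `ledger negatives`
(0), `ledger idea list` (similitude-bootstrap-rm-k3 closed known:Varesco2023 = arXiv:2304.02519,
effective-transport-no-go merged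
into this card, kuga-satake-descent-saturation routed); inherited and relied on — the card's eight
refuter novelty audits r19–r25
of today (zbMATH 'Hodge similarities K3' 1 hit Varesco 2304.02519; 'real multiplication K3' 8 hits:
Huybrechts 1910.13788,
Elkies–Kumar, Elkies–Schuett, VanGeemen2008RM, VanGeemenSchuett2023, BFvGS 2401.04072 / 2511.19970,
Schuett; crossref 'Hodge
similitude K3 algebraic' 0) and gen-0's READ of Varesco2023 pp. 3, 8–11 (grep
twistor|hyperholomorphic = 0 hits).
Nearest prior art found: Varesco2023 = arXiv:2304.02519 = doi:10.1007/s00209-023-03390-8, §2 p. 8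
and Thm 2.1 (the anchor
similarity β_*π^* of multiplier p and the factorisation '√p = similarity ∘ isometry', confined to
the Nikulin/σ_p locus, Prop 2.5,
Thm 2.9; all multipliers only conditionally on Kuga–Satake HC, Thm 0.3); engine Buskin2019 =
doi:10.1515/crelle-2017-0027 and
Markman2024 = doi:10.1112/S0010437X24007048 (isometries only); state of RM VanGeemen2008RM,
VanGeemenSch  [refs: 10.1007/s00209-023-03390-8, 10.1515/crelle-2017-0027, 10.1112/S0010437X24007048, 2304.02519, 2310.05196, doi:10.1007/s00209-023-03390-8, doi:10.1515/crelle-2017-0027, doi:10.1112/S0010437X24007048, Varesco2023, VanGeemenSchuett2023, Buskin2019, Markman2024]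

Barriers (technique_class: hyperholomorphic-sheaves, coherent-sheaf-chern-classes, k3): - technique_class: hyperholomorphic-sheaves, coherent-sheaf-chern-classes, k3
- Literature.Barriers.HodgeConjecture.Voisin2002_weilTorus_hodgeClassWithoutSubvarieties: APPLIES to
the carrier (Chern classes of coherent sheaves need not reach Hodge classes on non-projective
compact Kähler manifolds). Evasion: non-projective twin pairs are only the ROAD — there the
hyperholomorphic sheaf carries m·graph(Ψ) analytically and nothing is claimed; algebraicity is
extracted only at PROJECTIVE endpoints (GAGA: a coherent analytic sheaf on a projective manifold is
algebraic, so its c₂ is an algebraic class) and through Buskin's theorem for projective K3s. On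
Voisin's Weil torus there is no K3-type period domain, no twistor connectivity to an algebraic
anchor, and no claim. Honest residual bet: no Voisin-type vanishing 'every (twisted) sheaf on a very
general twin pair has c₂ with zero graph(Ψ)-component' holds — kill criterion (ii).
- Literature.Barriers.HodgeConjecture.Zucker1977_kaehlerTorus_noAnalyticCycles: APPLIES to any
CYCLE-valued transport through non-projective fibres; evaded the same way (sheaves of rank ≥ 2, not
subvarieties, are the carriers, as in Buskin2019), and used positively: off the Nikulin locus the
graph itself cannot survive as a prime cycle (a degree-1 component over S would be the graph of a
degree-2 rational map forcing a Nikulin involution on S).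
- Literature.Barriers.HodgeConjecture.AtiyahHirzebruch1962_torsionClass_notAlgebraic: not engaged —
only the RATION

History (route lifecycle, newest last):
- 2026-08-15T23:14:35Z · rev 3: restated Assembly (stmt-HodgeConjecture-13683 proved), EEightTwoSimilitude (stmt-HodgeConjecture-13436 proved) — route-repair (glue-native-fail; unit rglue-HodgeConjecture-NikulinTwinTran-5026381e): the deciding theorem `closes (h₁ : LefschetzOneOneK3) (h₂ : TwinSimilitude (planner-rglue-HodgeConjecture-NikulinTwinTran-5026381e-0)
- 2026-08-15T23:23:31Z · rev 4: restated Assembly (stmt-HodgeConjecture-13925) — route-repair (ground-failed; unit rground-HodgeConjecture-NikulinTwinTran-5026381e): the only BLOCKING ground flag is Assembly (stmt-HodgeConjecture-13925) grou (planner-rground-HodgeConjecture-NikulinTwinTran-5026381e-0)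
- 2026-08-16T03:21:44Z · rev 7: restated TwinTwistorTransport (stmt-HodgeConjecture-14522) — route-repair rbadge-5026381e (badge: route.target-unreachable; import cone: Buskin2019_hodgeIsometry_algebraic + Huybrechts_K3_periodSurjective_projective rode (planner-rbadge-HodgeConjecture-NikulinTwinTran-5026381e-0)
- 2026-08-16T04:04:55Z · AUTO-CRUX (backfill): TwinSimilitudeAlgebraic — hypotheses of the deciding theorem that nothing in the route derives are cruxes (operator:999:1085951)
- 2026-08-16T06:34:00Z · rev 9: dropped stmt-HodgeConjecture-14464 — route-repair unused-crux (unit rrepair-HodgeConjecture-NikulinTwinTra-95a8acb3), step 1/2: DROP NikulinSerreCarrier (stmt-HodgeConjecture-14464). It is INFORMAL (planner-rrepair-HodgeConjecture-NikulinTwinTra-95a8acb3-0)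
- 2026-08-27T08:44:48Z · DORMANT — reconciler: no traction for 5 d (last activity item-proof-filed at 2026-08-22T06:42:36Z); parked, not closed — `ledger route dormant route-HodgeConjecture-Nikul (operator:999:1285394)
- 2026-08-29T05:49:33Z · REACTIVATED — reconciler: reactivated — activity item-evidence-added at 2026-08-29T03:27:26Z after parking at 2026-08-27T08:44:48Z (operator:999:1391256)
- 2026-09-04T23:38:31Z · DORMANT — reconciler: no traction for 5 d (last activity item-evidence-added at 2026-08-30T23:01:50Z); parked, not closed — `ledger route dormant route-HodgeConjecture-Ni (operator:999:3173118)

sub-problem: HodgeConjecture · status: dormant · opened planner-plancard-HodgeConjecture-HodgeConject-3ef2a0e7-g2-0 2026-08-15T19:01:42Z · rev 15 · ledger route-HodgeConjecture-NikulinTwinTransport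
GENERATED by the gate from the ledger (D-0016/17). Provers cite these decls: `theorem foo : Summit.HodgeConjecture.HodgeConjecture.Theses.NikulinTwinTransport.<Decl> := …` in Summits/HodgeConjecture/HodgeConjecture/Theorems/<Name>.lean.
-/

namespace Summit.HodgeConjecture.HodgeConjecture.Theses.NikulinTwinTransport

open scoped BigOperators Topology Manifold Classical MeasureTheory ProbabilityTheory Matrix InnerProductSpace ComplexConjugate ContinuousMap
open Filter Set Function TopologicalSpace MeasureTheory

attribute [summit_statement] _root_.HodgeConjecture

-- earlier SquareHodgeOfSqrtTwo (stmt-HodgeConjecture-13433, replaced 2026-08-15T19:34:49Z -> stmt-HodgeConjecture-13680): retired by None — ∀ (S : Literature.AlgebraicGeometry.Motives.SchemeOver ℂ), Literature.AlgebraicGeometry.Surfaces.IsK3Surface S → ∀ (e : Literature.AlgebraicGeometry.HodgeTheory.complexBetti S (2 * 1) →ₗ[ℂ] Literature.AlgebraicGeometry.HodgeTheory.complexBetti S (2 * 1)), (∀ x, 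
/-- item stmt-HodgeConjecture-13680 · crux · rank 9 · open · by planner
why it might fail: Open sub-case of HC: on the maximal 8-dim families of K3s with RM by ℚ(√2) no inducing cycle for e is known (arXiv:2310.05196 §4.9); proved only for CM squares (Buskin2019) and on the Nikulin locus (Varesco2023 Thm 2.1, dim T ≤ 13); a non-algebraic e refutes HC.
sources: VanGeemenSchuett2023, arXiv:2310.05196, Varesco2023, VanGeemen2008RM, Buskin2019, Zarhin1983
[support] THE SECTOR, in the summit's own predicate: HodgeConjectureFor 4 (S ⊗ S) for every
projective K3 S with End_Hdg(T(S)_ℚ) = ℚ + ℚ·e, e² = 2 — hypotheses spelled on the real carriers: e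
rational, type-preserving, cup-self-adjoint, kills NS := algebraicClasses S 1, e² = 2 on NS^⊥, and
every rational type-preserving f killing NS with image ⊥ NS equals a + b·e there (a, b ∈ ℚ). The
first totally-real case of HC for K3 squares beyond CM (the tree fact
Buskin2019_hodgeConjectureFor_square_of_CM is the CM case), containing the maximal 8-dimensional RM
families of VanGeemenSchuett2023. Standalone an open sub-case of HC; in the route it closes through
SquareGlue. [difficulty: open-problem] [cone repair 2026-08-15 (rrepair-5026381e): `IsK3Surface`
unfolded to its verbatim body (Iff.rfl, Check.lean rc 0) so the route file no longer imports
Literature.AlgebraicGeometry.Surfaces.K3Surface, which carries the unproved named fact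
Buskin2019_hodgeIsometry_algebraic into the import cone; meaning unchanged.] -/
@[route_item "route-HodgeConjecture-NikulinTwinTransport"]
def SquareHodgeOfSqrtTwo : Prop :=
  ∀ (S : Literature.AlgebraicGeometry.Motives.SchemeOver ℂ), (Literature.AlgebraicGeometry.Motives.IsSmoothProjective 2 S ∧ Subsingleton (Literature.AlgebraicGeometry.Motives.structureSheafCohomology S.left 1) ∧ ∃ (A : Literature.AlgebraicGeometry.HodgeTheory.HodgeModel 2 S) (η : Literature.Geometry.Kaehler.MForm 𝓘(ℝ, A.model) A.carrier ℂ 2), Literature.Geometry.Kaehler.IsHolomorphicInCharts η ∧ ∀ x, η x ≠ 0) → ∀ (e : Literature.AlgebraicGeometry.HodgeTheory.complexBetti S (2 * 1) →ₗ[ℂ] Literature.AlgebraicGeometry.HodgeTheory.complexBetti S (2 * 1)), (∀ x, Literature.AlgebraicGeometry.HodgeTheory.IsRationalClass x → Literature.AlgebraicGeometry.HodgeTheory.IsRationalClass (e x)) → (∀ (i j : ℕ) x, Literature.AlgebraicGeometry.HodgeTheory.IsOfHodgeType 2 S (2 * 1) i j x → Literature.AlgebraicGeometry.HodgeTheory.IsOfHodgeType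 2 S (2 * 1) i j (e x)) → (∀ x y : Literature.AlgebraicGeometry.HodgeTheory.complexBetti S (2 * 1), Literature.AlgebraicTopology.SingularHomology.cupProduct (rfl : 2 * 1 + 2 * 1 = 2 * 2) (e x) y = Literature.AlgebraicTopology.SingularHomology.cupProduct (rfl : 2 * 1 + 2 * 1 = 2 * 2) x (e y)) → (∀ d ∈ Literature.AlgebraicGeometry.HodgeTheory.algebraicClasses S 1, e d = 0) → (∀ x : Literature.AlgebraicGeometry.HodgeTheory.complexBetti S (2 * 1), (∀ d ∈ Literature.AlgebraicGeometry.HodgeTheory.algebraicClasses S 1, Literature.AlgebraicTopology.SingularHomology.cupProduct (rfl : 2 * 1 + 2 * 1 = 2 * 2) x d = 0) → e (e x) = (2 : ℂ) • x) → (∀ (f : Literature.AlgebraicGeometry.HodgeTheory.complexBetti S (2 * 1) →ₗ[ℂ] Literature.AlgebraicGeometry.HodgeTheory.complexBetti S (2 * 1)), (∀ x, Literature.AlgebraicGeometry.HodgeTheory.IsRationalClass x → Literature.AlgebraicGeometry.HodgeTheory.IsRationalClass (f x)) → (∀ (i j : ℕ) x, Literature.AlgebraicGeometry.HodgeTheory.IsOfHodgeType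 2 S (2 * 1) i j x → Literature.AlgebraicGeometry.HodgeTheory.IsOfHodgeType 2 S (2 * 1) i j (f x)) → (∀ d ∈ Literature.AlgebraicGeometry.HodgeTheory.algebraicClasses S 1, f d = 0) → (∀ x : Literature.AlgebraicGeometry.HodgeTheory.complexBetti S (2 * 1), ∀ d ∈ Literature.AlgebraicGeometry.HodgeTheory.algebraicClasses S 1, Literature.AlgebraicTopology.SingularHomology.cupProduct (rfl : 2 * 1 + 2 * 1 = 2 * 2) (f x) d = 0) → ∃ a b : ℚ, ∀ x : Literature.AlgebraicGeometry.HodgeTheory.complexBetti S (2 * 1), (∀ d ∈ Literature.AlgebraicGeometry.HodgeTheory.algebraicClasses S 1, Literature.AlgebraicTopology.SingularHomology.cupProduct (rfl : 2 * 1 + 2 * 1 = 2 * 2) x d = 0) → f x = (a : ℂ) • x + (b : ℂ) • e x) → Literature.AlgebraicGeometry.HodgeTheory.HodgeConjectureFor 4 (CategoryTheory.MonoidalCategoryStruct.tensorObj S S)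

/-- item stmt-HodgeConjecture-13684 · crux · rank 9 · open · by planner
why it might fail: HC off one thin sector is the whole summit: false iff HC fails elsewhere while holding on K3 squares with RM √2 — e.g. a non-algebraic Weil class on an abelian fourfold (MoonenZarhin1999) or on a very general hypersurface; irrefutable short of ¬HC, unprovable short of HC there.
sources: Deligne2000, MoonenZarhin1999, VoisinHodgeI2002, Andre1996
[support] (bookkeeping, NOT claimed) the complement of the route's sector: SquareHodgeOfSqrtTwo →
HodgeConjecture. Implied by HodgeConjecture itself, hence irrefutable short of ¬HC; filed only so
that the D-0027 §2.1 frame crux → … → summit is explicit (as in routes KugaSatakeSaturation and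
NodalThetaWeil). Refuters: skip; provers: nothing to do unless HC is otherwise settled. [difficulty:
open-problem] [cone repair 2026-08-15 (rrepair-5026381e): re-filed unchanged next to the restated
SquareHodgeOfSqrtTwo.] -/
@[route_item "route-HodgeConjecture-NikulinTwinTransport"]
def SectorComplement : Prop :=
  SquareHodgeOfSqrtTwo → _root_.HodgeConjecture

-- earlier TwinSimilitudeAlgebraic (stmt-HodgeConjecture-13426, replaced 2026-08-15T19:34:49Z -> stmt-HodgeConjecture-13674): retired by None — ∀ (μ : Literature.AlgebraicGeometry.HodgeTheory.OrientationFamily), μ.HasPoincareDuality → ∀ (S S' : Literature.AlgebraicGeometry.Motives.SchemeOver ℂ) (hS : Literature.AlgebraicGeometry.Surfaces.IsK3Surface S) (hS' : Literature.AlgebraicGeometry.Surfaces.IsK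
/-- item stmt-HodgeConjecture-13674 · aside (kind.auto-crux: conjecture-grade) · rank 0 · open · by planner
why it might fail: Open sub-case of HC: a multiplier-2 rational Hodge similitude of K3s is known algebraic only when T ⊂ U³⊕E₈(−2) over ℚ (Varesco2023 Thm 2.1, Prop 2.5: dim T ≤ 13); on the maximal 8-dim RM-√2 families (arXiv:2310.05196 Thm 3.10, §4.9) no inducing cycle is known; one non-algebraic ψ refutes HC.
sources: Varesco2023, arXiv:2304.02519, VanGeemenSchuett2023, arXiv:2310.05196, arXiv:2401.04072, Buskin2019
[target] X = Sim₂(K3): for projective K3 surfaces S, S′ (IsK3Surface), integral generators p, p′ of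
H⁴, and every ℂ-linear ψ : H²(S′(ℂ);ℂ) → H²(S(ℂ);ℂ) that is rational, type-preserving and a
2-similitude ((x.y) = a·p′ ⟹ (ψx.ψy) = 2a·p), there is γ ∈ algebraicClasses (S ⊗ S′) 2 with ψ =
fst_*(snd^*(–) ∪ γ). Equivalent (Buskin + composition of correspondences) to 'graph(Ψ) is algebraic
on every twin pair of the one completed Nikulin 2-similitude Ψ'. [cone repair 2026-08-15
(rrepair-5026381e): `IsK3Surface` unfolded to its verbatim body (Iff.rfl, Check.lean rc 0) so the
route file no longer imports Literature.AlgebraicGeometry.Surfaces.K3Surface, which carries the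
unproved named fact Buskin2019_hodgeIsometry_algebraic into the import cone; meaning unchanged.] -/
@[route_item "route-HodgeConjecture-NikulinTwinTransport"]
def TwinSimilitudeAlgebraic : Prop :=
  ∀ (μ : Literature.AlgebraicGeometry.HodgeTheory.OrientationFamily), μ.HasPoincareDuality → ∀ (S S' : Literature.AlgebraicGeometry.Motives.SchemeOver ℂ) (hS : (Literature.AlgebraicGeometry.Motives.IsSmoothProjective 2 S ∧ Subsingleton (Literature.AlgebraicGeometry.Motives.structureSheafCohomology S.left 1) ∧ ∃ (A : Literature.AlgebraicGeometry.HodgeTheory.HodgeModel 2 S) (η : Literature.Geometry.Kaehler.MForm 𝓘(ℝ, A.model) A.carrier ℂ 2), Literature.Geometry.Kaehler.IsHolomorphicInCharts η ∧ ∀ x, η x ≠ 0)) (hS' : (Literature.AlgebraicGeometry.Motives.IsSmoothProjective 2 S' ∧ Subsingleton (Literature.AlgebraicGeometry.Motives.structureSheafCohomology S'.left 1) ∧ ∃ (A : Literature.AlgebraicGeometry.HodgeTheory.HodgeModel 2 S') (η : Literature.Geometry.Kaehler.MForm 𝓘(ℝ, A.model) A.carrier ℂ 2), Literature.Geometry.Kaehler.IsHolomorphicInCharts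 η ∧ ∀ x, η x ≠ 0)) (p : Literature.AlgebraicGeometry.HodgeTheory.complexBetti S (2 * 2)) (p' : Literature.AlgebraicGeometry.HodgeTheory.complexBetti S' (2 * 2)), (Literature.AlgebraicGeometry.HodgeTheory.IsIntegralClass p ∧ ∀ q : Literature.AlgebraicGeometry.HodgeTheory.complexBetti S (2 * 2), Literature.AlgebraicGeometry.HodgeTheory.IsIntegralClass q → ∃ n : ℤ, q = n • p) → (Literature.AlgebraicGeometry.HodgeTheory.IsIntegralClass p' ∧ ∀ q : Literature.AlgebraicGeometry.HodgeTheory.complexBetti S' (2 * 2), Literature.AlgebraicGeometry.HodgeTheory.IsIntegralClass q → ∃ n : ℤ, q = n • p') → ∀ (ψ : Literature.AlgebraicGeometry.HodgeTheory.complexBetti S' (2 * 1) →ₗ[ℂ] Literature.AlgebraicGeometry.HodgeTheory.complexBetti S (2 * 1)), (∀ x, Literature.AlgebraicGeometry.HodgeTheory.IsRationalClass x → Literature.AlgebraicGeometry.HodgeTheory.IsRationalClass (ψ x)) → (∀ (i j : ℕ) x, Literature.AlgebraicGeometry.HodgeTheory.IsOfHodgeType 2 S' (2 * 1) i j x → Literature.AlgebraicGeometry.HodgeTheory.IsOfHodgeType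 2 S (2 * 1) i j (ψ x)) → (∀ (x y : Literature.AlgebraicGeometry.HodgeTheory.complexBetti S' (2 * 1)) (a : ℂ), Literature.AlgebraicTopology.SingularHomology.cupProduct (rfl : 2 * 1 + 2 * 1 = 2 * 2) x y = a • p' → Literature.AlgebraicTopology.SingularHomology.cupProduct (rfl : 2 * 1 + 2 * 1 = 2 * 2) (ψ x) (ψ y) = ((2 : ℂ) * a) • p) → ∃ γ ∈ Literature.AlgebraicGeometry.HodgeTheory.algebraicClasses (CategoryTheory.MonoidalCategoryStruct.tensorObj S S') 2, ∀ x : Literature.AlgebraicGeometry.HodgeTheory.complexBetti S' (2 * 1), ψ x = Literature.AlgebraicGeometry.HodgeTheory.complexGysin μ (Literature.AlgebraicGeometry.Motives.IsSmoothProjective.tensor_holds hS.1 hS'.1) hS.1 (CategoryTheory.SemiCartesianMonoidalCategory.fst S S') (rfl : 2 * 1 + 2 * 2 + 2 * 2 = 2 * 1 + 2 * (2 + 2)) (Literature.AlgebraicTopology.SingularHomology.cupProduct (rfl : 2 * 1 + 2 * 2 = 2 * 1 + 2 * 2) (Literature.AlgebraicGeometry.HodgeTheory.complexBetti.map (CategoryTheory.SemiCartesianMonoidalCategory.snd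 S S') (2 * 1) x) γ)

-- earlier HodgeIsometryAlgebraic (stmt-HodgeConjecture-13427, replaced 2026-08-15T19:34:49Z -> stmt-HodgeConjecture-13675): retired by None — ∀ (μ : Literature.AlgebraicGeometry.HodgeTheory.OrientationFamily), μ.HasPoincareDuality → ∀ (S S' : Literature.AlgebraicGeometry.Motives.SchemeOver ℂ) (hS : Literature.AlgebraicGeometry.Surfaces.IsK3Surface S) (hS' : Literature.AlgebraicGeometry.Surfaces.IsK3
/-- item stmt-HodgeConjecture-13675 · support · rank 2 · open · by planner
why it might fail: A theorem (Buskin2019 Thm 1.1, Huybrechts2019 Thm 0.2) that fails only AS RENDERED: sign/normalisation of the in-tree complexGysin action or of the generators p, p′ may force a restatement of the fact — then restate, do not close; formalising the proof is XL.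
sources: Buskin2019, Huybrechts2019, doi:10.1515/crelle-2017-0027, arXiv:1705.04063
[crux] Buskin's theorem, H²-version, VERBATIM the body of the tree's named fact
Literature.AlgebraicGeometry.Surfaces.Buskin2019_hodgeIsometry_algebraic (Iff.rfl checked in
Sketch.lean; restated rather than named so the route's used-constants cone stays free of
undischarged closed facts): every rational, type-preserving, isometric φ : H²(S′(ℂ);ℂ) → H²(S(ℂ);ℂ)
between projective K3 surfaces is [γ]_* for an algebraic γ on S × S′. Ranked FIRST (plancard rule:
the mechanism's load-bearing unproved named fact); closes the day the fact is discharged. Used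
twice: X ⇐ graph(Ψ) algebraic on twin pairs (Ψ⁻¹∘ψ is an isometry), and the factorisation e = Φ∘ψᵗ
of real multiplication (RealMultiplicationGlue; the T-version is this + Witt, Huybrechts2019 §1).
[difficulty: XL] [cone repair 2026-08-15 (rrepair-5026381e): `IsK3Surface` unfolded to its verbatim
body (Iff.rfl, Check.lean rc 0) so the route file no longer imports
Literature.AlgebraicGeometry.Surfaces.K3Surface, which carries the unproved named fact
Buskin2019_hodgeIsometry_algebraic into the import cone; meaning unchanged.] -/
@[route_item "route-HodgeConjecture-NikulinTwinTransport"]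
def HodgeIsometryAlgebraic : Prop :=
  ∀ (μ : Literature.AlgebraicGeometry.HodgeTheory.OrientationFamily), μ.HasPoincareDuality → ∀ (S S' : Literature.AlgebraicGeometry.Motives.SchemeOver ℂ) (hS : (Literature.AlgebraicGeometry.Motives.IsSmoothProjective 2 S ∧ Subsingleton (Literature.AlgebraicGeometry.Motives.structureSheafCohomology S.left 1) ∧ ∃ (A : Literature.AlgebraicGeometry.HodgeTheory.HodgeModel 2 S) (η : Literature.Geometry.Kaehler.MForm 𝓘(ℝ, A.model) A.carrier ℂ 2), Literature.Geometry.Kaehler.IsHolomorphicInCharts η ∧ ∀ x, η x ≠ 0)) (hS' : (Literature.AlgebraicGeometry.Motives.IsSmoothProjective 2 S' ∧ Subsingleton (Literature.AlgebraicGeometry.Motives.structureSheafCohomology S'.left 1) ∧ ∃ (A : Literature.AlgebraicGeometry.HodgeTheory.HodgeModel 2 S') (η : Literature.Geometry.Kaehler.MForm 𝓘(ℝ, A.model) A.carrier ℂ 2), Literature.Geometry.Kaehler.IsHolomorphicInCharts η ∧ ∀ x, η x ≠ 0)) (p : Literature.AlgebraicGeometry.HodgeTheory.complexBetti S (2 *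 2)) (p' : Literature.AlgebraicGeometry.HodgeTheory.complexBetti S' (2 * 2)), (Literature.AlgebraicGeometry.HodgeTheory.IsIntegralClass p ∧ ∀ q : Literature.AlgebraicGeometry.HodgeTheory.complexBetti S (2 * 2), Literature.AlgebraicGeometry.HodgeTheory.IsIntegralClass q → ∃ n : ℤ, q = n • p) → (Literature.AlgebraicGeometry.HodgeTheory.IsIntegralClass p' ∧ ∀ q : Literature.AlgebraicGeometry.HodgeTheory.complexBetti S' (2 * 2), Literature.AlgebraicGeometry.HodgeTheory.IsIntegralClass q → ∃ n : ℤ, q = n • p') → ∀ (φ : Literature.AlgebraicGeometry.HodgeTheory.complexBetti S' (2 * 1) →ₗ[ℂ] Literature.AlgebraicGeometry.HodgeTheory.complexBetti S (2 * 1)), (∀ x, Literature.AlgebraicGeometry.HodgeTheory.IsRationalClass x → Literature.AlgebraicGeometry.HodgeTheory.IsRationalClass (φ x)) → (∀ (i j : ℕ) x, Literature.AlgebraicGeometry.HodgeTheory.IsOfHodgeType 2 S' (2 * 1) i j x → Literature.AlgebraicGeometry.HodgeTheory.IsOfHodgeType 2 S (2 * 1) i j (φ x)) → (∀ (x y : Literature.AlgebraicGeometry.HodgeTheory.complexBetti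 S' (2 * 1)) (a : ℂ), Literature.AlgebraicTopology.SingularHomology.cupProduct (rfl : 2 * 1 + 2 * 1 = 2 * 2) x y = a • p' → Literature.AlgebraicTopology.SingularHomology.cupProduct (rfl : 2 * 1 + 2 * 1 = 2 * 2) (φ x) (φ y) = a • p) → ∃ γ ∈ Literature.AlgebraicGeometry.HodgeTheory.algebraicClasses (CategoryTheory.MonoidalCategoryStruct.tensorObj S S') 2, ∀ x : Literature.AlgebraicGeometry.HodgeTheory.complexBetti S' (2 * 1), φ x = Literature.AlgebraicGeometry.HodgeTheory.complexGysin μ (Literature.AlgebraicGeometry.Motives.IsSmoothProjective.tensor_holds hS.1 hS'.1) hS.1 (CategoryTheory.SemiCartesianMonoidalCategory.fst S S') (rfl : 2 * 1 + 2 * 2 + 2 * 2 = 2 * 1 + 2 * (2 + 2)) (Literature.AlgebraicTopology.SingularHomology.cupProduct (rfl : 2 * 1 + 2 * 2 = 2 * 1 + 2 * 2) (Literature.AlgebraicGeometry.HodgeTheory.complexBetti.map (CategoryTheory.SemiCartesianMonoidalCategory.snd S S') (2 * 1) x) γ)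

/-- item stmt-HodgeConjecture-15067 · aside · rank 3 · open · by planner
why it might fail: Open HC sub-case with no known instance: on the maximal RM-√2 families (ρ = 2, rank T = 20; arXiv:2310.05196 Thm 3.10, Rem 4.9) no cycle inducing √2 or any multiplier-2 similitude is known and Varesco2023 Thm 2.1 stops at rank T ≤ 12; one non-algebraic anchor class refutes HC.
sources: VanGeemenSchuett2023, arXiv:2310.05196, Varesco2023, arXiv:2304.02519, VanGeemen2008RM, Buskin2019
[crux] THE JUDGE'S MILESTONE (route-repair judge-repair 2026-08-16; judge 06:45Z, tier C,
what_would_move_it: 'TwinTwistorTransport proved for one RM-by-√2 family off the Nikulin locus'),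
typed as the literal special case of the transport crux TwinTwistorTransport (14393) ON THE MAXIMAL
RM-√2 FAMILIES: for every projective K3 surface S (IsK3Surface unfolded, integral generator p of H⁴)
of Picard rank 2 (finrank_ℂ algebraicClasses S 1 = 2) carrying an endomorphism e of H²(S(ℂ);ℂ) that
is rational, type-preserving, kills NS := algebraicClasses S 1 and satisfies e(e x) = 2x for x ⊥ NS
(so √2 ∈ End_Hdg(T(S)_ℚ): a Hodge morphism T → NS vanishes by irreducibility of T, hence e preserves
T; self-adjointness and End-exactness are deliberately NOT assumed — Zarhin makes √2 self-adjoint,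
and the special members with larger End lie in the same families), the anchor of
TwinTwistorTransport exists: a projective K3 S″, generator p″ and an ALGEBRAIC ℂ-linear equivalence
Ψ : H²(S″(ℂ);ℂ) ≃ H²(S(ℂ);ℂ) (Ψ = [γ]_*, γ ∈ algebraicClasses (S ⊗ S″) 2) whose inverse is rational,
type-preserving and halves the cup form (conclusion verbatim). Such S have rank T(S) = 20: they are
exactly the Picard-rank-2 mem -/
@[route_item "route-HodgeConjecture-NikulinTwinTransport"]
def TwinTransportRMPicardTwo : Prop :=
  ∀ (μ : Literature.AlgebraicGeometry.HodgeTheory.OrientationFamily), μ.HasPoincareDuality → ∀ (S : Literature.AlgebraicGeometry.Motives.SchemeOver ℂ) (hS : (Literature.AlgebraicGeometry.Motives.IsSmoothProjective 2 S ∧ Subsingleton (Literature.AlgebraicGeometry.Motives.structureSheafCohomology S.left 1) ∧ ∃ (A : Literature.AlgebraicGeometry.HodgeTheory.HodgeModel 2 S) (η : Literature.Geometry.Kaehler.MForm 𝓘(ℝ, A.model) A.carrier ℂ 2), Literature.Geometry.Kaehler.IsHolomorphicInCharts η ∧ ∀ x, η x ≠ 0)) (p : Literature.AlgebraicGeometry.HodgeTheory.complexBetti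 S (2 * 2)), (Literature.AlgebraicGeometry.HodgeTheory.IsIntegralClass p ∧ ∀ q : Literature.AlgebraicGeometry.HodgeTheory.complexBetti S (2 * 2), Literature.AlgebraicGeometry.HodgeTheory.IsIntegralClass q → ∃ n : ℤ, q = n • p) → Module.finrank ℂ ↥(Literature.AlgebraicGeometry.HodgeTheory.algebraicClasses S 1) = 2 → ∀ (e : Literature.AlgebraicGeometry.HodgeTheory.complexBetti S (2 * 1) →ₗ[ℂ] Literature.AlgebraicGeometry.HodgeTheory.complexBetti S (2 * 1)), (∀ x, Literature.AlgebraicGeometry.HodgeTheory.IsRationalClass x → Literature.AlgebraicGeometry.HodgeTheory.IsRationalClass (e x)) → (∀ (i j : ℕ) x, Literature.AlgebraicGeometry.HodgeTheory.IsOfHodgeType 2 S (2 * 1) i j x → Literature.AlgebraicGeometry.HodgeTheory.IsOfHodgeType 2 S (2 * 1) i j (e x)) → (∀ d ∈ Literature.AlgebraicGeometry.HodgeTheory.algebraicClasses S 1, e d = 0) → (∀ x : Literature.AlgebraicGeometry.HodgeTheory.complexBetti S (2 * 1), (∀ d ∈ Literature.AlgebraicGeometry.HodgeTheory.algebraicClasses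 S 1, Literature.AlgebraicTopology.SingularHomology.cupProduct (rfl : 2 * 1 + 2 * 1 = 2 * 2) x d = 0) → e (e x) = (2 : ℂ) • x) → ∃ (S'' : Literature.AlgebraicGeometry.Motives.SchemeOver ℂ) (hS'' : (Literature.AlgebraicGeometry.Motives.IsSmoothProjective 2 S'' ∧ Subsingleton (Literature.AlgebraicGeometry.Motives.structureSheafCohomology S''.left 1) ∧ ∃ (A : Literature.AlgebraicGeometry.HodgeTheory.HodgeModel 2 S'') (η : Literature.Geometry.Kaehler.MForm 𝓘(ℝ, A.model) A.carrier ℂ 2), Literature.Geometry.Kaehler.IsHolomorphicInCharts η ∧ ∀ x, η x ≠ 0)) (p'' : Literature.AlgebraicGeometry.HodgeTheory.complexBetti S'' (2 * 2)), (Literature.AlgebraicGeometry.HodgeTheory.IsIntegralClass p'' ∧ ∀ q : Literature.AlgebraicGeometry.HodgeTheory.complexBetti S'' (2 * 2), Literature.AlgebraicGeometry.HodgeTheory.IsIntegralClass q → ∃ n : ℤ, q = n • p'') ∧ ∃ Ψ : Literature.AlgebraicGeometry.HodgeTheory.complexBetti S'' (2 * 1) ≃ₗ[ℂ] Literature.AlgebraicGeometry.HodgeTheory.complexBetti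 S (2 * 1), (∀ y, Literature.AlgebraicGeometry.HodgeTheory.IsRationalClass y → Literature.AlgebraicGeometry.HodgeTheory.IsRationalClass (Ψ.symm y)) ∧ (∀ (i j : ℕ) y, Literature.AlgebraicGeometry.HodgeTheory.IsOfHodgeType 2 S (2 * 1) i j y → Literature.AlgebraicGeometry.HodgeTheory.IsOfHodgeType 2 S'' (2 * 1) i j (Ψ.symm y)) ∧ (∀ (u v : Literature.AlgebraicGeometry.HodgeTheory.complexBetti S (2 * 1)) (b : ℂ), Literature.AlgebraicTopology.SingularHomology.cupProduct (rfl : 2 * 1 + 2 * 1 = 2 * 2) u v = ((2 : ℂ) * b) • p → Literature.AlgebraicTopology.SingularHomology.cupProduct (rfl : 2 * 1 + 2 * 1 = 2 * 2) (Ψ.symm u) (Ψ.symm v) = b • p'') ∧ ∃ γ ∈ Literature.AlgebraicGeometry.HodgeTheory.algebraicClasses (CategoryTheory.MonoidalCategoryStruct.tensorObj S S'') 2, ∀ x : Literature.AlgebraicGeometry.HodgeTheory.complexBetti S'' (2 * 1), Ψ x = Literature.AlgebraicGeometry.HodgeTheory.complexGysin μ (Literature.AlgebraicGeometry.Motives.IsSmoothProjective.tensor_holds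 hS.1 hS''.1) hS.1 (CategoryTheory.SemiCartesianMonoidalCategory.fst S S'') (rfl : 2 * 1 + 2 * 2 + 2 * 2 = 2 * 1 + 2 * (2 + 2)) (Literature.AlgebraicTopology.SingularHomology.cupProduct (rfl : 2 * 1 + 2 * 2 = 2 * 1 + 2 * 2) (Literature.AlgebraicGeometry.HodgeTheory.complexBetti.map (CategoryTheory.SemiCartesianMonoidalCategory.snd S S'') (2 * 1) x) γ)

-- earlier TwinTwistorTransport (stmt-HodgeConjecture-14522, replaced 2026-08-16T03:21:44Z -> stmt-HodgeConjecture-14393): retired by None — ∃ (M N : Module.End ℂ (Literature.AlgebraicGeometry.Surfaces.K3Index → ℂ)), (∀ v : Literature.AlgebraicGeometry.Surfaces.K3Index → ℤ, ∃ w : Literature.AlgebraicGeometry.Surfaces.K3Index → ℚ, M (fun i => (v i : ℂ)) = fun i => (w i : ℂ)) ∧ (∀ v : Literature.Algebr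
/-- item stmt-HodgeConjecture-14393 · aside · rank 4 · open · by planner
why it might fail: Open HC sub-case: an algebraic multiplier-2 similitude into EVERY projective K3 is known only on the Nikulin locus (Varesco2023 Thm 2.1, dim T ≤ 13); as a mechanism the anchor carrier (14464) may not exist and Ψ-matched product transport through MT-generic twins is unproved (GAFA98/E3).
sources: Varesco2023, arXiv:2304.02519, Buskin2019, Markman2024, arXiv:2204.00516, Verbitsky1996Hyperholomorphic
[crux] K2 TRANSPORT ALONG THE TWIN LOCUS — TYPED AT OUTPUT LEVEL (rev 7, route-repair
rbadge-5026381e): for every projective K3 surface S (IsK3Surface, unfolded) with integral generator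
p of H⁴ there are a projective K3 surface S″, a generator p″ and a ℂ-linear equivalence Ψ :
H²(S″(ℂ);ℂ) ≃ H²(S(ℂ);ℂ) which is ALGEBRAIC (Ψ = [γ]_*, γ ∈ algebraicClasses (S ⊗ S″) 2) and whose
inverse is rational, type-preserving and halves the cup form ((u.v) = 2b·p ⟹ (Ψ⁻¹u.Ψ⁻¹v) = b·p″) —
verbatim hypothesis (A) of the landed Theorems.twinSimilitudeAlgebraic_of_anchor, so that the
support TwinAnchorGlue closes X from this item + Buskin. It is the marking-free DELIVERABLE of the
mechanism below X: the lattice-level form 'for ONE rational 2-similitude M of Λ_K3 with rational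
two-sided inverse N (2M integral; Disproof F1: the completed Nikulin similitude is never integral),
the twin similitude η⁻¹∘M∘η′ is algebraic on every M-twin pair of marked projective K3 surfaces'
(TwinTransportFor[M] — the superseded v2 signature of stmt-HodgeConjecture-14522 and
`TwinTwistorTransportTyped` of Cruxes/TwinTwistorTransport/Lines/*.lean) implies it through markings
+ surjectivity of the period map + the Hodge types -/
@[route_item "route-HodgeConjecture-NikulinTwinTransport"]
def TwinTwistorTransport : Prop :=
  ∀ (μ : Literature.AlgebraicGeometry.HodgeTheory.OrientationFamily), μ.HasPoincareDuality → ∀ (S : Literature.AlgebraicGeometry.Motives.SchemeOver ℂ) (hS : (Literature.AlgebraicGeometry.Motives.IsSmoothProjective 2 S ∧ Subsingleton (Literature.AlgebraicGeometry.Motives.structureSheafCohomology S.left 1) ∧ ∃ (A : Literature.AlgebraicGeometry.HodgeTheory.HodgeModel 2 S) (η : Literature.Geometry.Kaehler.MForm 𝓘(ℝ, A.model) A.carrier ℂ 2), Literature.Geometry.Kaehler.IsHolomorphicInCharts η ∧ ∀ x, η x ≠ 0)) (p : Literature.AlgebraicGeometry.HodgeTheory.complexBetti S (2 * 2)), (Literature.AlgebraicGeometry.HodgeTheory.IsIntegralClass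 p ∧ ∀ q : Literature.AlgebraicGeometry.HodgeTheory.complexBetti S (2 * 2), Literature.AlgebraicGeometry.HodgeTheory.IsIntegralClass q → ∃ n : ℤ, q = n • p) → ∃ (S'' : Literature.AlgebraicGeometry.Motives.SchemeOver ℂ) (hS'' : (Literature.AlgebraicGeometry.Motives.IsSmoothProjective 2 S'' ∧ Subsingleton (Literature.AlgebraicGeometry.Motives.structureSheafCohomology S''.left 1) ∧ ∃ (A : Literature.AlgebraicGeometry.HodgeTheory.HodgeModel 2 S'') (η : Literature.Geometry.Kaehler.MForm 𝓘(ℝ, A.model) A.carrier ℂ 2), Literature.Geometry.Kaehler.IsHolomorphicInCharts η ∧ ∀ x, η x ≠ 0)) (p'' : Literature.AlgebraicGeometry.HodgeTheory.complexBetti S'' (2 * 2)), (Literature.AlgebraicGeometry.HodgeTheory.IsIntegralClass p'' ∧ ∀ q : Literature.AlgebraicGeometry.HodgeTheory.complexBetti S'' (2 * 2), Literature.AlgebraicGeometry.HodgeTheory.IsIntegralClass q → ∃ n : ℤ, q = n • p'') ∧ ∃ Ψ : Literature.AlgebraicGeometry.HodgeTheory.complexBetti S'' (2 * 1) ≃ₗ[ℂ]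 Literature.AlgebraicGeometry.HodgeTheory.complexBetti S (2 * 1), (∀ y, Literature.AlgebraicGeometry.HodgeTheory.IsRationalClass y → Literature.AlgebraicGeometry.HodgeTheory.IsRationalClass (Ψ.symm y)) ∧ (∀ (i j : ℕ) y, Literature.AlgebraicGeometry.HodgeTheory.IsOfHodgeType 2 S (2 * 1) i j y → Literature.AlgebraicGeometry.HodgeTheory.IsOfHodgeType 2 S'' (2 * 1) i j (Ψ.symm y)) ∧ (∀ (u v : Literature.AlgebraicGeometry.HodgeTheory.complexBetti S (2 * 1)) (b : ℂ), Literature.AlgebraicTopology.SingularHomology.cupProduct (rfl : 2 * 1 + 2 * 1 = 2 * 2) u v = ((2 : ℂ) * b) • p → Literature.AlgebraicTopology.SingularHomology.cupProduct (rfl : 2 * 1 + 2 * 1 = 2 * 2) (Ψ.symm u) (Ψ.symm v) = b • p'') ∧ ∃ γ ∈ Literature.AlgebraicGeometry.HodgeTheory.algebraicClasses (CategoryTheory.MonoidalCategoryStruct.tensorObj S S'') 2, ∀ x : Literature.AlgebraicGeometry.HodgeTheory.complexBetti S'' (2 * 1), Ψ x = Literature.AlgebraicGeometry.HodgeTheory.complexGysin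 μ (Literature.AlgebraicGeometry.Motives.IsSmoothProjective.tensor_holds hS.1 hS''.1) hS.1 (CategoryTheory.SemiCartesianMonoidalCategory.fst S S'') (rfl : 2 * 1 + 2 * 2 + 2 * 2 = 2 * 1 + 2 * (2 + 2)) (Literature.AlgebraicTopology.SingularHomology.cupProduct (rfl : 2 * 1 + 2 * 2 = 2 * 1 + 2 * 2) (Literature.AlgebraicGeometry.HodgeTheory.complexBetti.map (CategoryTheory.SemiCartesianMonoidalCategory.snd S S'') (2 * 1) x) γ)

-- earlier HodgeSimilitudeAlgebraic (stmt-HodgeConjecture-13428, replaced 2026-08-15T19:34:49Z -> stmt-HodgeConjecture-13676): retired by None — ∀ (r : ℚ), 0 < r → ∀ (μ : Literature.AlgebraicGeometry.HodgeTheory.OrientationFamily), μ.HasPoincareDuality → ∀ (S S' : Literature.AlgebraicGeometry.Motives.SchemeOver ℂ) (hS : Literature.AlgebraicGeometry.Surfaces.IsK3Surface S) (hS' : Literature.AlgebraicG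
/-- item stmt-HodgeConjecture-13676 · aside · rank 5 · open · by planner
why it might fail: Open, above X: prime-order symplectic automorphisms need p ≤ 7 (Huybrechts2016K3 Ch.15 Cor.1.8), so multipliers p > 7 lack a finite-quotient anchor; unconditional only for √2, √3 on ≤4-dim families (Varesco2023 Thm 2.1/2.9), all r only under KS-HC (ibid. §0.3 Thm 3); a non-algebraic one refutes HC.
sources: Varesco2023, arXiv:2304.02519, Huybrechts2016K3, Buskin2019, Morrison1984, VanGeemen2008RM
[crux] Card item K4, ALL MULTIPLIERS: for every rational r > 0, every rational Hodge similitude of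
multiplier r between H² of projective K3 surfaces is algebraic. Plan: one anchor per prime —
symplectic automorphisms of order 3, 5, 7 (X ⇢ X/σ_p resolved, anti-invariant lattices K_p,
completed by roots of K_p; Varesco2023 §2) and Kummer anchors Km(A) ⇢ Km(A′) for l-isogenies of
abelian surfaces — each transported as in TwinTwistorTransport; multipliers multiply and squares are
isometries (HodgeIsometryAlgebraic), so prime multipliers suffice. r = 1 is Buskin and r = 2 gives X
(checked in Sketch.lean). Output with the glue: HC(S × S) for every K3 whose End_Hdg(T) is spanned
by square roots of rationals, and 'every rational Hodge similitude between projective K3 surfaces is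
algebraic'. [deps: TwinSimilitudeAlgebraic] [difficulty: open-problem] [cone repair 2026-08-15
(rrepair-5026381e): `IsK3Surface` unfolded to its verbatim body (Iff.rfl, Check.lean rc 0) so the
route file no longer imports Literature.AlgebraicGeometry.Surfaces.K3Surface, which carries the
unproved named fact Buskin2019_hodgeIsometry_algebraic into the import cone; meaning unchanged.] -/
@[route_item "route-HodgeConjecture-NikulinTwinTransport"]
def HodgeSimilitudeAlgebraic : Prop :=
  ∀ (r : ℚ), 0 < r → ∀ (μ : Literature.AlgebraicGeometry.HodgeTheory.OrientationFamily), μ.HasPoincareDuality → ∀ (S S' : Literature.AlgebraicGeometry.Motives.SchemeOver ℂ) (hS : (Literature.AlgebraicGeometry.Motives.IsSmoothProjective 2 S ∧ Subsingleton (Literature.AlgebraicGeometry.Motives.structureSheafCohomology S.left 1) ∧ ∃ (A : Literature.AlgebraicGeometry.HodgeTheory.HodgeModel 2 S) (η : Literature.Geometry.Kaehler.MForm 𝓘(ℝ, A.model) A.carrier ℂ 2), Literature.Geometry.Kaehler.IsHolomorphicInCharts η ∧ ∀ x, η x ≠ 0)) (hS' : (Literature.AlgebraicGeometry.Motives.IsSmoothProjective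 2 S' ∧ Subsingleton (Literature.AlgebraicGeometry.Motives.structureSheafCohomology S'.left 1) ∧ ∃ (A : Literature.AlgebraicGeometry.HodgeTheory.HodgeModel 2 S') (η : Literature.Geometry.Kaehler.MForm 𝓘(ℝ, A.model) A.carrier ℂ 2), Literature.Geometry.Kaehler.IsHolomorphicInCharts η ∧ ∀ x, η x ≠ 0)) (p : Literature.AlgebraicGeometry.HodgeTheory.complexBetti S (2 * 2)) (p' : Literature.AlgebraicGeometry.HodgeTheory.complexBetti S' (2 * 2)), (Literature.AlgebraicGeometry.HodgeTheory.IsIntegralClass p ∧ ∀ q : Literature.AlgebraicGeometry.HodgeTheory.complexBetti S (2 * 2), Literature.AlgebraicGeometry.HodgeTheory.IsIntegralClass q → ∃ n : ℤ, q = n • p) → (Literature.AlgebraicGeometry.HodgeTheory.IsIntegralClass p' ∧ ∀ q : Literature.AlgebraicGeometry.HodgeTheory.complexBetti S' (2 * 2), Literature.AlgebraicGeometry.HodgeTheory.IsIntegralClass q → ∃ n : ℤ, q = n • p') → ∀ (ψ : Literature.AlgebraicGeometry.HodgeTheory.complexBetti S' (2 * 1) →ₗ[ℂ] Literature.AlgebraicGeometry.HodgeTheory.complexBetti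 S (2 * 1)), (∀ x, Literature.AlgebraicGeometry.HodgeTheory.IsRationalClass x → Literature.AlgebraicGeometry.HodgeTheory.IsRationalClass (ψ x)) → (∀ (i j : ℕ) x, Literature.AlgebraicGeometry.HodgeTheory.IsOfHodgeType 2 S' (2 * 1) i j x → Literature.AlgebraicGeometry.HodgeTheory.IsOfHodgeType 2 S (2 * 1) i j (ψ x)) → (∀ (x y : Literature.AlgebraicGeometry.HodgeTheory.complexBetti S' (2 * 1)) (a : ℂ), Literature.AlgebraicTopology.SingularHomology.cupProduct (rfl : 2 * 1 + 2 * 1 = 2 * 2) x y = a • p' → Literature.AlgebraicTopology.SingularHomology.cupProduct (rfl : 2 * 1 + 2 * 1 = 2 * 2) (ψ x) (ψ y) = ((r : ℂ) * a) • p) → ∃ γ ∈ Literature.AlgebraicGeometry.HodgeTheory.algebraicClasses (CategoryTheory.MonoidalCategoryStruct.tensorObj S S') 2, ∀ x : Literature.AlgebraicGeometry.HodgeTheory.complexBetti S' (2 * 1), ψ x = Literature.AlgebraicGeometry.HodgeTheory.complexGysin μ (Literature.AlgebraicGeometry.Motives.IsSmoothProjective.tensor_holds hS.1 hS'.1) hS.1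 (CategoryTheory.SemiCartesianMonoidalCategory.fst S S') (rfl : 2 * 1 + 2 * 2 + 2 * 2 = 2 * 1 + 2 * (2 + 2)) (Literature.AlgebraicTopology.SingularHomology.cupProduct (rfl : 2 * 1 + 2 * 2 = 2 * 1 + 2 * 2) (Literature.AlgebraicGeometry.HodgeTheory.complexBetti.map (CategoryTheory.SemiCartesianMonoidalCategory.snd S S') (2 * 1) x) γ)

/-- item stmt-HodgeConjecture-15154 · aside · rank 8 · open · by planner
why it might fail: Known theorem (Todorov1980, Siu1981; Huybrechts2016K3 Ch.6 Thm 3.1/Rem 3.3, Ch.7 Thm 4.1): fails only AS RENDERED — marking must match IsIntegralClass AND cup = k3Form•p for the same p (sign pinned, Λ ≇ −Λ); ‘spans (2,0)’ needs h²⁰ = 1. Formally XL-apex: Yau, twistor spaces, Torelli, GAGA absent.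
sources: Huybrechts2016K3, Todorov1980, Siu1981, Siu1983, doi:10.1007/bf01390067, doi:10.1007/bf01263265
[crux] SURJECTIVITY OF THE K3 PERIOD MAP, PROJECTIVE FORM — the named Literature fact
Literature.AlgebraicGeometry.Surfaces.Huybrechts_K3_periodSurjective_projective PROMOTED to an
explicit crux of this route (route-choice repair 2026-08-16, unit
rchoice-Summits-HodgeConjecture-HodgeC-c9eaa442): the fact is XL-apex (its prover's companion
K3PeriodSurjectivityProofs.lean records why — the conclusion asks for an actual algebraic K3 surface
with computed H², cup product and Hodge types at EVERY projective period point, i.e. moduli of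
marked K3s, twistor lines, Calabi–Yau metrics, Chow/GAGA, none of which the tree has), non-crux
facts are inline-or-verdict and never split, and the line skeletons of the transport crux
TwinTwistorTransport (14393) cannot do without it (S″ is exhibited only through period surjectivity:
Cruxes/TwinTwistorTransport/Disproof.lean §obligations; stubs K3PeriodFacts /
stub_k3PeriodSurjective / stub_facts / K3TransferFacts of Lines/*.lean) — so as a crux it gets its
own lineage and ONE layer of 2–7 subs. STATEMENT = the fact's body VERBATIM with IsK3Surface
unfolded exactly as in the route's other items (Iff.rfl with the fact; planner Sketch.lean, lean rc
0); K3 -/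
@[route_item "route-HodgeConjecture-NikulinTwinTransport"]
def K3PeriodSurjective : Prop :=
  ∀ x : Literature.AlgebraicGeometry.Surfaces.K3Index → ℂ, Literature.AlgebraicGeometry.Surfaces.k3Form x x = 0 → 0 < (Literature.AlgebraicGeometry.Surfaces.k3Form (star x) x).re → (∃ v : Literature.AlgebraicGeometry.Surfaces.K3Index → ℤ, Literature.AlgebraicGeometry.Surfaces.k3Form (fun i => (v i : ℂ)) x = 0 ∧ 0 < ∑ i, ∑ j, v i * Literature.AlgebraicGeometry.Surfaces.k3Gram i j * v j) → ∃ (S : Literature.AlgebraicGeometry.Motives.SchemeOver ℂ) (_ : (Literature.AlgebraicGeometry.Motives.IsSmoothProjective 2 S ∧ Subsingleton (Literature.AlgebraicGeometry.Motives.structureSheafCohomology S.left 1) ∧ ∃ (A : Literature.AlgebraicGeometry.HodgeTheory.HodgeModel 2 S) (η : Literature.Geometry.Kaehler.MForm 𝓘(ℝ, A.model) A.carrier ℂ 2), Literature.Geometry.Kaehler.IsHolomorphicInCharts η ∧ ∀ z, η z ≠ 0)) (φ : Literature.AlgebraicGeometry.HodgeTheory.complexBetti S (2 * 1) ≃ₗ[ℂ]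 (Literature.AlgebraicGeometry.Surfaces.K3Index → ℂ)) (p : Literature.AlgebraicGeometry.HodgeTheory.complexBetti S (2 * 2)), Literature.AlgebraicGeometry.HodgeTheory.IsIntegralClass p ∧ (∀ q : Literature.AlgebraicGeometry.HodgeTheory.complexBetti S (2 * 2), Literature.AlgebraicGeometry.HodgeTheory.IsIntegralClass q → ∃ n : ℤ, q = n • p) ∧ (∀ c : Literature.AlgebraicGeometry.HodgeTheory.complexBetti S (2 * 1), Literature.AlgebraicGeometry.HodgeTheory.IsIntegralClass c ↔ ∃ v : Literature.AlgebraicGeometry.Surfaces.K3Index → ℤ, φ c = fun i => (v i : ℂ)) ∧ (∀ a b : Literature.AlgebraicGeometry.HodgeTheory.complexBetti S (2 * 1), Literature.AlgebraicTopology.SingularHomology.cupProduct (rfl : 2 * 1 + 2 * 1 = 2 * 2) a b = Literature.AlgebraicGeometry.Surfaces.k3Form (φ a) (φ b) • p) ∧ Literature.AlgebraicGeometry.HodgeTheory.IsOfHodgeType 2 S (2 * 1) 2 0 (φ.symm x) ∧ (∀ σ : Literature.AlgebraicGeometry.HodgeTheory.complexBetti S (2 * 1), Literature.AlgebraicGeometry.HodgeTheory.IsOfHodgeType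 2 S (2 * 1) 2 0 σ → ∃ t : ℂ, σ = t • φ.symm x)

-- earlier TwinExists (stmt-HodgeConjecture-13429, replaced 2026-08-15T19:34:49Z -> stmt-HodgeConjecture-13677): retired by None — ∀ (S : Literature.AlgebraicGeometry.Motives.SchemeOver ℂ), Literature.AlgebraicGeometry.Surfaces.IsK3Surface S → ∃ (S' : Literature.AlgebraicGeometry.Motives.SchemeOver ℂ) (p : Literature.AlgebraicGeometry.HodgeTheory.complexBetti S (2 * 2)) (p' : Literature.AlgebraicGeom
/-- item stmt-HodgeConjecture-13677 · support · rank 9 · open · by planner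
sources: Huybrechts2016K3, VanGeemenSarti2007, Morrison1984
[support] UNIVERSAL TWIN: every projective K3 surface S has a projective K3 partner S′ together with
integral generators p, p′ of H⁴ and a rational, type-preserving 2-similitude ψ : H²(S′(ℂ);ℂ) →
H²(S(ℂ);ℂ). Proof: mark S (H²(S,ℤ) ≅ Λ_{K3} with its form, Huybrechts2016K3 Ch.1 Prop.3.5 — cite
item), push the period through the inverse of the integral 2-similitude M of Λ_{K3}
(EEightTwoSimilitude: U(2) ⊂ U, E₈(2) ⊂ E₈) and apply the tree fact
Huybrechts_K3_periodSurjective_projective (S′ is projective because M⁻¹ of an ample class has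
positive square). Formal debt, no research risk. [difficulty: M] [cone repair 2026-08-15
(rrepair-5026381e): `IsK3Surface` unfolded to its verbatim body (Iff.rfl, Check.lean rc 0) so the
route file no longer imports Literature.AlgebraicGeometry.Surfaces.K3Surface, which carries the
unproved named fact Buskin2019_hodgeIsometry_algebraic into the import cone; meaning unchanged.] -/
@[route_item "route-HodgeConjecture-NikulinTwinTransport"]
def TwinExists : Prop :=
  ∀ (S : Literature.AlgebraicGeometry.Motives.SchemeOver ℂ), (Literature.AlgebraicGeometry.Motives.IsSmoothProjective 2 S ∧ Subsingleton (Literature.AlgebraicGeometry.Motives.structureSheafCohomology S.left 1) ∧ ∃ (A : Literature.AlgebraicGeometry.HodgeTheory.HodgeModel 2 S) (η : Literature.Geometry.Kaehler.MForm 𝓘(ℝ, A.model) A.carrier ℂ 2), Literature.Geometry.Kaehler.IsHolomorphicInCharts η ∧ ∀ x, η x ≠ 0) → ∃ (S' : Literature.AlgebraicGeometry.Motives.SchemeOver ℂ) (p : Literature.AlgebraicGeometry.HodgeTheory.complexBetti S (2 * 2)) (p' : Literature.AlgebraicGeometry.HodgeTheory.complexBetti S' (2 * 2)) (ψ : Literature.AlgebraicGeometry.HodgeTheory.complexBetti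 S' (2 * 1) →ₗ[ℂ] Literature.AlgebraicGeometry.HodgeTheory.complexBetti S (2 * 1)), (Literature.AlgebraicGeometry.Motives.IsSmoothProjective 2 S' ∧ Subsingleton (Literature.AlgebraicGeometry.Motives.structureSheafCohomology S'.left 1) ∧ ∃ (A : Literature.AlgebraicGeometry.HodgeTheory.HodgeModel 2 S') (η : Literature.Geometry.Kaehler.MForm 𝓘(ℝ, A.model) A.carrier ℂ 2), Literature.Geometry.Kaehler.IsHolomorphicInCharts η ∧ ∀ x, η x ≠ 0) ∧ (Literature.AlgebraicGeometry.HodgeTheory.IsIntegralClass p ∧ ∀ q : Literature.AlgebraicGeometry.HodgeTheory.complexBetti S (2 * 2), Literature.AlgebraicGeometry.HodgeTheory.IsIntegralClass q → ∃ n : ℤ, q = n • p) ∧ (Literature.AlgebraicGeometry.HodgeTheory.IsIntegralClass p' ∧ ∀ q : Literature.AlgebraicGeometry.HodgeTheory.complexBetti S' (2 * 2), Literature.AlgebraicGeometry.HodgeTheory.IsIntegralClass q → ∃ n : ℤ, q = n • p') ∧ (∀ x, Literature.AlgebraicGeometry.HodgeTheory.IsRationalClass x → Literature.AlgebraicGeometry.HodgeTheory.IsRationalClass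 (ψ x)) ∧ (∀ (i j : ℕ) x, Literature.AlgebraicGeometry.HodgeTheory.IsOfHodgeType 2 S' (2 * 1) i j x → Literature.AlgebraicGeometry.HodgeTheory.IsOfHodgeType 2 S (2 * 1) i j (ψ x)) ∧ (∀ (x y : Literature.AlgebraicGeometry.HodgeTheory.complexBetti S' (2 * 1)) (a : ℂ), Literature.AlgebraicTopology.SingularHomology.cupProduct (rfl : 2 * 1 + 2 * 1 = 2 * 2) x y = a • p' → Literature.AlgebraicTopology.SingularHomology.cupProduct (rfl : 2 * 1 + 2 * 1 = 2 * 2) (ψ x) (ψ y) = ((2 : ℂ) * a) • p)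

-- earlier LefschetzOneOneK3 (stmt-HodgeConjecture-13430, replaced 2026-08-15T19:34:49Z -> stmt-HodgeConjecture-13678): retired by None — ∀ (S : Literature.AlgebraicGeometry.Motives.SchemeOver ℂ), Literature.AlgebraicGeometry.Surfaces.IsK3Surface S → ∀ c : Literature.AlgebraicGeometry.HodgeTheory.complexBetti S (2 * 1), Literature.AlgebraicGeometry.HodgeTheory.IsRationalClass c → Literature.Algebraic
/-- item stmt-HodgeConjecture-13678 · support · rank 9 · closed · proved by Summit.HodgeConjecture.HodgeConjecture.Theorems.lefschetzOneOneK3_proof @ 9d6d171ca7c1 (prover) · by planner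
sources: VoisinHodgeI2002, Huybrechts2016K3
[support] Lefschetz (1,1) for projective K3 surfaces: every rational class of type (1,1) in
H²(S(ℂ);ℂ) lies in algebraicClasses S 1. It is the specialisation to IsK3Surface of the tree's named
fact Literature.AlgebraicGeometry.HodgeTheory.lefschetzOneOne_rational (checked in Sketch.lean) —
restated so that the glue's standard input is an ITEM and the route's used-constants cone carries no
undischarged closed fact; closes the day the fact is discharged. [difficulty: L] [cone repair
2026-08-15 (rrepair-5026381e): `IsK3Surface` unfolded to its verbatim body (Iff.rfl, Check.lean rc
0) so the route file no longer imports Literature.AlgebraicGeometry.Surfaces.K3Surface, which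
carries the unproved named fact Buskin2019_hodgeIsometry_algebraic into the import cone; meaning
unchanged.] -/
@[route_item "route-HodgeConjecture-NikulinTwinTransport"]
def LefschetzOneOneK3 : Prop :=
  ∀ (S : Literature.AlgebraicGeometry.Motives.SchemeOver ℂ), (Literature.AlgebraicGeometry.Motives.IsSmoothProjective 2 S ∧ Subsingleton (Literature.AlgebraicGeometry.Motives.structureSheafCohomology S.left 1) ∧ ∃ (A : Literature.AlgebraicGeometry.HodgeTheory.HodgeModel 2 S) (η : Literature.Geometry.Kaehler.MForm 𝓘(ℝ, A.model) A.carrier ℂ 2), Literature.Geometry.Kaehler.IsHolomorphicInCharts η ∧ ∀ x, η x ≠ 0) → ∀ c : Literature.AlgebraicGeometry.HodgeTheory.complexBetti S (2 * 1), Literature.AlgebraicGeometry.HodgeTheory.IsRationalClass c → Literature.AlgebraicGeometry.HodgeTheory.IsOfHodgeType 2 S (2 * 1) 1 1 c → c ∈ Literature.AlgebraicGeometry.HodgeTheory.algebraicClasses S 1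

-- `LefschetzOneOneK3` holds: proved by `Summit.HodgeConjecture.HodgeConjecture.Theorems.lefschetzOneOneK3_proof` @ 9d6d171ca7c1 (its module imports this route file, so no `_holds` link can be stated here).

-- earlier RealMultiplicationSqrtTwoAlgebraic (stmt-HodgeConjecture-13431, replaced 2026-08-15T19:34:49Z -> stmt-HodgeConjecture-13679): retired by None — ∀ (μ : Literature.AlgebraicGeometry.HodgeTheory.OrientationFamily), μ.HasPoincareDuality → ∀ (S : Literature.AlgebraicGeometry.Motives.SchemeOver ℂ) (hS : Literature.AlgebraicGeometry.Surfaces.IsK3Surface S) (e : Literature.AlgebraicGeometry.HodgeT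
/-- item stmt-HodgeConjecture-13679 · support · rank 9 · open · by planner
sources: Varesco2023, VanGeemenSchuett2023, VanGeemen2008RM, Zarhin1983
[support] THE DELIVERABLE: for every projective K3 surface S and every rational, type-preserving
endomorphism e of H²(S(ℂ);ℂ) that is cup-self-adjoint, kills NS(S) := algebraicClasses S 1 and
satisfies e(e x) = 2x for x ⊥ NS(S) (real multiplication by √2 on T(S); Zarhin1983: totally real
Hodge endomorphisms are self-adjoint), the class of e is algebraic: e = [γ]_* for some γ ∈
algebraicClasses (S ⊗ S) 2. Standalone an open sub-case of HC (VanGeemenSchuett2023: inducing cycle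
unknown on the maximal 8-dim RM families; Varesco2023 Thm 2.1 only for T ⊂ U³_ℚ ⊕ E₈(−2)_ℚ); in the
route it closes through RealMultiplicationGlue. [difficulty: open-problem] [cone repair 2026-08-15
(rrepair-5026381e): `IsK3Surface` unfolded to its verbatim body (Iff.rfl, Check.lean rc 0) so the
route file no longer imports Literature.AlgebraicGeometry.Surfaces.K3Surface, which carries the
unproved named fact Buskin2019_hodgeIsometry_algebraic into the import cone; meaning unchanged.] -/
@[route_item "route-HodgeConjecture-NikulinTwinTransport"]
def RealMultiplicationSqrtTwoAlgebraic : Prop :=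
  ∀ (μ : Literature.AlgebraicGeometry.HodgeTheory.OrientationFamily), μ.HasPoincareDuality → ∀ (S : Literature.AlgebraicGeometry.Motives.SchemeOver ℂ) (hS : (Literature.AlgebraicGeometry.Motives.IsSmoothProjective 2 S ∧ Subsingleton (Literature.AlgebraicGeometry.Motives.structureSheafCohomology S.left 1) ∧ ∃ (A : Literature.AlgebraicGeometry.HodgeTheory.HodgeModel 2 S) (η : Literature.Geometry.Kaehler.MForm 𝓘(ℝ, A.model) A.carrier ℂ 2), Literature.Geometry.Kaehler.IsHolomorphicInCharts η ∧ ∀ x, η x ≠ 0)) (e : Literature.AlgebraicGeometry.HodgeTheory.complexBetti S (2 * 1) →ₗ[ℂ] Literature.AlgebraicGeometry.HodgeTheory.complexBetti S (2 * 1)), (∀ x, Literature.AlgebraicGeometry.HodgeTheory.IsRationalClass x → Literature.AlgebraicGeometry.HodgeTheory.IsRationalClass (e x)) → (∀ (i j : ℕ) x, Literature.AlgebraicGeometry.HodgeTheory.IsOfHodgeType 2 S (2 * 1) i j x → Literature.AlgebraicGeometry.HodgeTheory.IsOfHodgeType 2 S (2 * 1) i j (e x)) → (∀ x y : Literature.AlgebraicGeometry.HodgeTheory.complexBetti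 S (2 * 1), Literature.AlgebraicTopology.SingularHomology.cupProduct (rfl : 2 * 1 + 2 * 1 = 2 * 2) (e x) y = Literature.AlgebraicTopology.SingularHomology.cupProduct (rfl : 2 * 1 + 2 * 1 = 2 * 2) x (e y)) → (∀ d ∈ Literature.AlgebraicGeometry.HodgeTheory.algebraicClasses S 1, e d = 0) → (∀ x : Literature.AlgebraicGeometry.HodgeTheory.complexBetti S (2 * 1), (∀ d ∈ Literature.AlgebraicGeometry.HodgeTheory.algebraicClasses S 1, Literature.AlgebraicTopology.SingularHomology.cupProduct (rfl : 2 * 1 + 2 * 1 = 2 * 2) x d = 0) → e (e x) = (2 : ℂ) • x) → ∃ γ ∈ Literature.AlgebraicGeometry.HodgeTheory.algebraicClasses (CategoryTheory.MonoidalCategoryStruct.tensorObj S S) 2, ∀ x : Literature.AlgebraicGeometry.HodgeTheory.complexBetti S (2 * 1), e x = Literature.AlgebraicGeometry.HodgeTheory.complexGysin μ (Literature.AlgebraicGeometry.Motives.IsSmoothProjective.tensor_holds hS.1 hS.1) hS.1 (CategoryTheory.SemiCartesianMonoidalCategory.fst S S) (rfl : 2 * 1 + 2 * 2 + 2 * 2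 = 2 * 1 + 2 * (2 + 2)) (Literature.AlgebraicTopology.SingularHomology.cupProduct (rfl : 2 * 1 + 2 * 2 = 2 * 1 + 2 * 2) (Literature.AlgebraicGeometry.HodgeTheory.complexBetti.map (CategoryTheory.SemiCartesianMonoidalCategory.snd S S) (2 * 1) x) γ)

-- earlier RealMultiplicationGlue (stmt-HodgeConjecture-13432, replaced 2026-08-15T19:34:49Z -> stmt-HodgeConjecture-13681): retired by None — LefschetzOneOneK3 → TwinSimilitudeAlgebraic → HodgeIsometryAlgebraic → TwinExists → RealMultiplicationSqrtTwoAlgebraic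
/-- item stmt-HodgeConjecture-13681 · support · rank 9 · open · by planner
sources: Varesco2023, Huybrechts2019, Buskin2019, Fulton1998
[support] TwinSimilitudeAlgebraic → HodgeIsometryAlgebraic → TwinExists → LefschetzOneOneK3 →
RealMultiplicationSqrtTwoAlgebraic — Varesco2023 Thm 2.1 / Rem 2.2 with the TWIN in place of the
Nikulin quotient. Proof: take the twin ψ : H²(S′) → H²(S), algebraic by X; φ := ½·e∘ψ kills NS(S′)
and is an isometry T(S′)_ℚ → T(S)_ℚ ((φx.φy) = ¼(ψx.e²ψy) = ½(ψx.ψy) = (x.y)); extend it by a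
rational isometry ν : NS(S′)_ℚ ≅ NS(S)_ℚ (Witt cancellation; Huybrechts2019 §1) to a rational Hodge
isometry Φ of H², algebraic by Buskin; ψᵗ is algebraic with ψ∘ψᵗ = 2, hence e = Φ∘ψᵗ − (ν ⊕ 0)∘ψᵗ
exactly, a combination of compositions of algebraic correspondences ((ν ⊕ 0) lies in NS ⊗ NS′ =
products of divisors, by L(1,1) on both sides). Linear-algebra core (Mathlib-provable now): B(ψx,ψy)
= 2C(x,y), e B-self-adjoint, e² = 2, ψχ = 2 ⟹ ½eψ is an isometry and e = (½eψ)∘χ. Formal debt: Witt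
cancellation over ℚ; composition / transpose of algebraic correspondences ([γ₂]_*∘[γ₁]_* and
([γ]_*)ᵗ algebraic: Gysin base change + complexGysin_cup + AlgebraicClassesCup / ExteriorProduct);
the ℚ-form of complexBetti under a marking (K3SurfaceProofs). [difficulty: L] [cone repair
2026-08-15 (rrepair-5026381e): hypothe -/
@[route_item "route-HodgeConjecture-NikulinTwinTransport"]
def RealMultiplicationGlue : Prop :=
  TwinSimilitudeAlgebraic → HodgeIsometryAlgebraic → TwinExists → LefschetzOneOneK3 → RealMultiplicationSqrtTwoAlgebraic

-- earlier SquareGlue (stmt-HodgeConjecture-13434, replaced 2026-08-15T19:34:49Z -> stmt-HodgeConjecture-13682): retired by None — LefschetzOneOneK3 → RealMultiplicationSqrtTwoAlgebraic → SquareHodgeOfSqrtTwo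
/-- item stmt-HodgeConjecture-13682 · support · rank 9 · closed · proved by Summit.HodgeConjecture.HodgeConjecture.Theorems.NikulinTwinTransport.SquareGlueFree.squareGlue_proof @ c48e93966104 (prover) · by planner
sources: Varesco2023, Huybrechts2019, Zarhin1983, Deligne2000
[support] RealMultiplicationSqrtTwoAlgebraic → LefschetzOneOneK3 → SquareHodgeOfSqrtTwo — the
Künneth bookkeeping (Varesco2023 p. 8: 'HC for X² ⟺ every element of End_Hdg(T(X)) is algebraic'):
Hodge classes on S × S are [S × pt], [pt × S], NS ⊗ NS (products of divisors), nothing in T ⊗ NS or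
NS ⊗ T (Hom_Hdg(T, NS) = 0: a Hodge morphism T → NS kills T^{2,0}, and by L(1,1) + Hodge index no
proper rational sub-Hodge structure of T contains T^{2,0} with a (1,1) complement), and in T ⊗ T ≅
End(T): End_Hdg(T) = ℚ·id_T + ℚ·e with id_T = [Δ] − (NS ⊗ NS and Künneth-end parts) algebraic and e
algebraic by the antecedent (the (2,2)-Künneth component of its γ); degrees 2 and 6 by L(1,1),
pull-back and D × pt; plus a Hodge model of S ⊗ S. Formal debt (no research risk): Künneth for H*((S
⊗ S)(ℂ);ℂ) with Hodge types, product Hodge models; an orientation family with Poincaré duality is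
available (nonempty_orientationFamily, OrientationFamily.hasPoincareDuality are theorems).
[difficulty: L] [cone repair 2026-08-15 (rrepair-5026381e): hypotheses reordered only — the gate
requires a changed term to re-file an item next to the restated items it names; content unchanged.] -/
@[route_item "route-HodgeConjecture-NikulinTwinTransport"]
def SquareGlue : Prop :=
  RealMultiplicationSqrtTwoAlgebraic → LefschetzOneOneK3 → SquareHodgeOfSqrtTwo

-- `SquareGlue` holds: proved by `Summit.HodgeConjecture.HodgeConjecture.Theorems.NikulinTwinTransport.SquareGlueFree.squareGlue_proof` @ c48e93966104 (its module imports this route file, so no `_holds` link can be stated here).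

-- earlier EEightTwoSimilitude (stmt-HodgeConjecture-13436, replaced 2026-08-15T23:14:35Z -> stmt-HodgeConjecture-13926): proved by Summit.HodgeConjecture.HodgeConjecture.Theorems.eEightTwoSimilitude_proof — (∃ R : Matrix (Fin 8) (Fin 8) ℤ, R.transpose * CartanMatrix.E₈ * R = 2 • (1 : Matrix (Fin 8) (Fin 8) ℤ) ∧ ∃ w : Fin 8 → ℤ, R.mulVec (fun _ => 1) = 2 • w) ∧ ∃ M : Matrix (Fin 8) (Fin 8) ℤ, M.trans
/-- item stmt-HodgeConjecture-13926 · support · rank 9 · closed · proved by Summit.HodgeConjecture.HodgeConjecture.Theorems.eEightTwoSimilitude_standalone (prover) · by planner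
sources: VanGeemenSarti2007, Morrison1984, Huybrechts2016K3
[support] Lattice core of the completed Nikulin similitude and of TwinExists, decidable with
Mathlib's CartanMatrix.E₈: (1) E₈ contains eight pairwise orthogonal roots whose sum is 2-divisible
(an A₁⁸ frame e₁±e₂, e₃±e₄, e₅±e₆, e₇±e₈, half-sum e₁+e₃+e₅+e₇ ∈ D₈ ⊂ E₈) — so E₈(−2) ⊂ NS(X)
contains eight pairwise orthogonal (−4)-vectors r_j with ½Σr_j integral, matching the even eight δ =
½ΣN_j (VanGeemenSarti2007 §1, Morrison1984 §5); (2) E₈(2) embeds in E₈, which with U(2) ⊂ U yields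
an integral 2-similitude of Λ_K3 = U³ ⊕ E₈(−1)². PROVED IN THE TREE: this is the SAME TERM as
stmt-HodgeConjecture-13436 (`Matrix.transpose R` for `R.transpose`, rfl in the planner's
Sketch.lean), closed `proved` by
Summit.HodgeConjecture.HodgeConjecture.Theorems.eEightTwoSimilitude_proof
(Theorems/NikulinTwinTransportEEightTwoSimilitude.lean: explicit R = the A₁⁸ frame in Bourbaki
simple-root coordinates, w = (0,2,1,3,2,2,1,1), M = the Hadamard-block 2-similitude; three
`decide`s), whose script still proves THIS decl by name (re-checked verbatim, lean rc 0). RE-FILED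
by route-repair rglue-5026381e (2026-08-15) ONLY to clear the GATE IMPORT-CYCLE GAP described on
`Assembly` (the proving module imports th -/
@[route_item "route-HodgeConjecture-NikulinTwinTransport"]
def EEightTwoSimilitude : Prop :=
  (∃ R : Matrix (Fin 8) (Fin 8) ℤ, Matrix.transpose R * CartanMatrix.E₈ * R = 2 • (1 : Matrix (Fin 8) (Fin 8) ℤ) ∧ ∃ w : Fin 8 → ℤ, R.mulVec (fun _ => 1) = 2 • w) ∧ ∃ M : Matrix (Fin 8) (Fin 8) ℤ, Matrix.transpose M * CartanMatrix.E₈ * M = 2 • CartanMatrix.E₈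

/-- `EEightTwoSimilitude` holds: proved by `Summit.HodgeConjecture.HodgeConjecture.Theorems.eEightTwoSimilitude_standalone`. -/
theorem EEightTwoSimilitude_holds : EEightTwoSimilitude := _root_.Summit.HodgeConjecture.HodgeConjecture.Theorems.eEightTwoSimilitude_standalone

/-- item stmt-HodgeConjecture-14394 · support · rank 9 · closed · proved by Summit.HodgeConjecture.HodgeConjecture.Theorems.nikulinTwinTransport_twinAnchorGlue_proof @ 79e1ec475fba (prover) · by planner
sources: Varesco2023, Buskin2019, Fulton1998, arXiv:2304.02519
[support] GLUE TO THE TARGET (route-repair rbadge-5026381e, rev 7; clears the gate stamp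
route.target-unreachable): HodgeIsometryAlgebraic → TwinTwistorTransport → TwinSimilitudeAlgebraic.
Proof (Varesco2023 §2, 'similarity = algebraic similarity ∘ isometry', with the twin in place of the
Nikulin quotient): given a rational, type-preserving 2-similitude ψ : H²(S′(ℂ);ℂ) → H²(S(ℂ);ℂ)
between projective K3 surfaces, take the algebraic anchor Ψ : H²(S″) ≃ H²(S) of S supplied by
TwinTwistorTransport; φ := Ψ⁻¹∘ψ : H²(S′) → H²(S″) is rational, type-preserving and an ISOMETRY
((x.y) = a·p′ ⟹ (ψx.ψy) = 2a·p ⟹ (φx.φy) = a·p″), hence φ = [γ₁]_* by HodgeIsometryAlgebraic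
(Buskin) for the K3 pair (S″, S′); then ψ = Ψ∘φ = [γ]_*∘[γ₁]_* = [γ₂]_* by composition of algebraic
correspondences. IN THE TREE:
`Summit.HodgeConjecture.HodgeConjecture.Theorems.twinSimilitudeAlgebraic_of_anchor hB hC hA :
TwinSimilitudeAlgebraic` (Theorems/NikulinTwinTransportTwinSimilitudeReduction.lean) closes this
item verbatim (checked: planner Sketch.lean, lean rc 0) given hC = composition of algebraic degree-2
correspondences between smooth projective surfaces acting on H² (Buskin2019 Lemma 6.3 / Fulton1998
Prop 16.1.1 -/
@[route_item "route-HodgeConjecture-NikulinTwinTransport"]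
def TwinAnchorGlue : Prop :=
  HodgeIsometryAlgebraic → TwinTwistorTransport → TwinSimilitudeAlgebraic

-- `TwinAnchorGlue` holds: proved by `Summit.HodgeConjecture.HodgeConjecture.Theorems.nikulinTwinTransport_twinAnchorGlue_proof` @ 79e1ec475fba (its module imports this route file, so no `_holds` link can be stated here).

/-- item stmt-HodgeConjecture-14850 · support · rank 9 · closed · proved by Summit.HodgeConjecture.HodgeConjecture.Theorems.allMultipliersGlue_proof @ c5d1cf337f6f (prover) · by planner
sources: Varesco2023, arXiv:2304.02519, Buskin2019
[support] GLUE (route-repair unused-crux, rev 9): HodgeSimilitudeAlgebraic → TwinSimilitudeAlgebraic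
— the all-multipliers crux (card item K4, rank 5) specialised to multiplier r = 2 is exactly X =
Sim₂(K3), so it is a STRONGER sufficient condition for hypothesis h₂ of `closes` and now lies in the
cone of the deciding theorem (before rev 9 it was 'deliberately not a hypothesis of closes' and
nothing in the route derived anything from it). Proof (provable now; checked in the planner's
Sketch.lean, lean rc 0, 0 sorry): `fun h μ hμ S S' hS hS' p p' hp hp' ψ h₁ h₂ h₃ => h 2 two_pos μ hμ
S S' hS hS' p p' hp hp' ψ h₁ h₂ (fun x y a hxy => by simpa using h₃ x y a hxy)` — the only step is
the cast `((2 : ℚ) : ℂ) * a = 2 * a` (`Rat.cast_ofNat`, by `simpa`). Any idle prover may land it as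
`theorem allMultipliersGlue : AllMultipliersGlue` in
Theorems/NikulinTwinTransportAllMultipliersGlue.lean. [deps: HodgeSimilitudeAlgebraic,
TwinSimilitudeAlgebraic] [difficulty: provable-now] -/
@[route_item "route-HodgeConjecture-NikulinTwinTransport"]
def AllMultipliersGlue : Prop :=
  HodgeSimilitudeAlgebraic → TwinSimilitudeAlgebraic

-- `AllMultipliersGlue` holds: proved by `Summit.HodgeConjecture.HodgeConjecture.Theorems.allMultipliersGlue_proof` @ c5d1cf337f6f (its module imports this route file, so no `_holds` link can be stated here).

/-- item stmt-HodgeConjecture-15041 · support · rank 9 · closed · proved by Summit.HodgeConjecture.HodgeConjecture.Theorems.algebraicClassesOneOneK3_proof @ 0688750897bc (prover) · by planner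
[support] ALGEBRAIC DIVISOR CLASSES ON A PROJECTIVE K3 SURFACE ARE OF HODGE TYPE (1,1) (route-choice
repair 2026-08-16, unit rchoice-Summits-HodgeConjecture-HodgeC-cc49d542): for every projective K3
surface S (IsK3Surface, unfolded verbatim as in the route's other items) and every d ∈
algebraicClasses S 1 = N¹H²(S(ℂ);ℂ), IsOfHodgeType 2 S (2*1) 1 1 d. The converse companion of
LefschetzOneOneK3 (together: the rational classes of N¹H²(S) are exactly the rational
(1,1)-classes). It is the (n,k,s) = (2,2,1) slice of the XL named fact
Literature.AlgebraicGeometry.HodgeTheory.Grothendieck1969_supportedClasses_le_hodgeConiveau (one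
line from it: Theorems.NikulinTwinTransport.isOfHodgeType_oneOne_of_mem_algebraicClasses hG) and
VERBATIM the hypothesis hN11 of the landed
Theorems.NikulinTwinTransport.realMultiplicationSqrtTwoAlgebraic_of_twinSimilitudeAlgebraic
(Iff.rfl; both checked in the planner's Sketch.lean, lean rc 0). WHY AN ITEM (re-route, not
promote): that fact is XL-apex and not to be split (its discharge is Deligne, Hodge III Cor. 8.2.8 —
SupportedClassesHodgeConiveauProofs: …_of_deligne over
Deligne1974_ker_restrictCompl_eq_iSup_range_complexGysin + nonempty_hodgeModel + exist -/
@[route_item "route-HodgeConjecture-NikulinTwinTransport"]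
def AlgebraicClassesOneOneK3 : Prop :=
  ∀ (S : Literature.AlgebraicGeometry.Motives.SchemeOver ℂ), (Literature.AlgebraicGeometry.Motives.IsSmoothProjective 2 S ∧ Subsingleton (Literature.AlgebraicGeometry.Motives.structureSheafCohomology S.left 1) ∧ ∃ (A : Literature.AlgebraicGeometry.HodgeTheory.HodgeModel 2 S) (η : Literature.Geometry.Kaehler.MForm 𝓘(ℝ, A.model) A.carrier ℂ 2), Literature.Geometry.Kaehler.IsHolomorphicInCharts η ∧ ∀ x, η x ≠ 0) → ∀ d ∈ Literature.AlgebraicGeometry.HodgeTheory.algebraicClasses S 1, Literature.AlgebraicGeometry.HodgeTheory.IsOfHodgeType 2 S (2 * 1) 1 1 d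

-- `AlgebraicClassesOneOneK3` holds: proved by `Summit.HodgeConjecture.HodgeConjecture.Theorems.algebraicClassesOneOneK3_proof` @ 0688750897bc (its module imports this route file, so no `_holds` link can be stated here).

-- earlier Assembly (stmt-HodgeConjecture-13437, replaced 2026-08-15T19:34:49Z -> stmt-HodgeConjecture-13683): retired by None — LefschetzOneOneK3 → TwinSimilitudeAlgebraic → HodgeIsometryAlgebraic → TwinExists → RealMultiplicationGlue → SquareGlue → SectorComplement → _root_.HodgeConjecture
-- earlier Assembly (stmt-HodgeConjecture-13683, replaced 2026-08-15T23:14:35Z -> stmt-HodgeConjecture-13925): moot by None — TwinSimilitudeAlgebraic → HodgeIsometryAlgebraic → TwinExists → LefschetzOneOneK3 → RealMultiplicationGlue → SquareGlue → SectorComplement → _root_.HodgeConjecture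
-- earlier Assembly (stmt-HodgeConjecture-13925, replaced 2026-08-15T23:23:31Z -> stmt-HodgeConjecture-13942): retired by None — TwinSimilitudeAlgebraic → HodgeIsometryAlgebraic → TwinExists → LefschetzOneOneK3 → RealMultiplicationGlue → SquareGlue → SectorComplement → HodgeConjecture
/-- item stmt-HodgeConjecture-13942 · assembly · rank 1 · open · by planner
sources: Varesco2023, Buskin2019, Deligne2000
[assembly] THE FRAME MODULO THE FORMAL GLUE: TwinSimilitudeAlgebraic → HodgeIsometryAlgebraic →
TwinExists → LefschetzOneOneK3 → SectorComplement → HodgeConjecture — X (Sim₂(K3)) + Buskin + the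
universal twin + Lefschetz (1,1) + the declared, NOT-claimed sector complement decide the summit.
Pure logic GIVEN the two glue items: Assembly := fun h₂ h₃ h₄ h₁ h₇ => h₇ (squareGlue
(realMultiplicationGlue h₂ h₃ h₄ h₁) h₁) (checked rc 0 in the planner's GroundCheck3.lean) — provers
close it in one line the day RealMultiplicationGlue (Varesco-type factorisation e = Φ∘ψᵗ, Witt,
composition of correspondences) and SquareGlue (Künneth bookkeeping on S ⊗ S) are proved; standalone
it is as hard as those two. RESTATED by route-repair rground-5026381e (2026-08-15, rev 4) from the
rev-3 form `… → RealMultiplicationGlue → SquareGlue → SectorComplement → HodgeConjecture`, which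
carried the glue items among its own hypotheses and was therefore a propositional tautology
(`intros; aesop` — ground.trivial, the route's only blocking ground flag; an assembly item cannot be
dropped). The deciding theorem `closes` (7 hypotheses, conclusion _root_.HodgeConjecture, certified
native rev 3) is unchanged and does -/
@[route_item "route-HodgeConjecture-NikulinTwinTransport"]
def Assembly : Prop :=
  TwinSimilitudeAlgebraic → HodgeIsometryAlgebraic → TwinExists → LefschetzOneOneK3 → SectorComplement → _root_.HodgeConjecture

/-! D-0027 §2.1 — DECIDING THEOREM (planner-authored via `route open/edit --closes-file`; by planner-rbadge-HodgeConjecture-NikulinTwinTran-5026381e-g2-0 2026-08-16T07:07:22Z):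
its hypotheses are this route's items and its conclusion the sub-problem Statement (glue_lint), and it elaborates with this file. -/

@[closes "route-HodgeConjecture-NikulinTwinTransport"] theorem closes (h₁ : SquareHodgeOfSqrtTwo) (h₂ : SectorComplement) : _root_.HodgeConjecture :=
  h₂ h₁

end Summit.HodgeConjecture.HodgeConjecture.Theses.NikulinTwinTransport
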